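import Summits.Schanuel.Schanuel.Theses.RoyCriterion
import Summits.Schanuel.Schanuel.Theorems.RoyCriterionRankOne
import Literature.NumberTheory.Transcendental.RankOneGridTrdeg
import Literature.NumberTheory.Transcendental.KirbyWeakSchanuelAx
import Literature.Barriers.Schanuel.NesterenkoModularScope
import Literature.Barriers.Schanuel.EFunctionValuesAtAlgebraicPoints
import Literature.Barriers.Schanuel.AlgebraicIndependenceOfLogarithmsProofs
import Literature.NumberTheory.Transcendental.LindemannWeierstrassProofs
import Summits.Schanuel.Schanuel.Theorems.RoySmallValueDirichletGap.Negative.TauLtOneAndCountLeDegreeFalse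

/-!
# Disproof of `RoyThesisTyped` (crux `stmt-Schanuel-0463`) — standing adversary file

Crux (route `RoyCriterion`, decl `Summit.Schanuel.Schanuel.Theses.RoyCriterion.RoyThesisTyped`):
`∀ n, Literature.NumberTheory.Transcendental.RoyCriterion n` — Roy's Conjecture 2 (Acta Arith. 97
(2001), §1) for every rank `l`: for `y : Fin l → ℂ` linearly independent over `ℚ`, `α : Fin l → ℂˣ`,
admissible parameters `(s₀,s₁,t₀,t₁,u)` in the window (1) and the small-value hypothesis
`RoyHypothesis y α …` on `D^k P_N` at the points `(Σ mⱼyⱼ, Π αⱼ^{mⱼ})`, conclude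
`l ≤ trdeg_ℚ ℚ(y, α)`.

## Findings (everything outside `-- Near-misses` is sorry-free)

* §0 READ-BACK / REDUCTIONS. `crux_iff` (body, `Iff.rfl`); **`crux_iff_summit : RoyThesisTyped ↔
  Schanuel`** (both directions are kernel theorems in tree: `Roy2001_iff_holds`); hence
  `not_crux_iff_exists_counterexample` — a disproof of the crux is EXACTLY a `ℚ`-linearly
  independent `y : Fin l → ℂ` with `trdeg ℚ(y, e^y) < l`; ranks `0, 1` hold in tree
  (`crux_rank_zero`, `crux_rank_one` = Hermite–Lindemann), so `two_le_of_not_royCriterion`: a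
  counterexample has rank `≥ 2`, and `crux_iff_forall_two_le`; rank `2` of the crux is the route's
  own crux `SchanuelTwo` (`royCriterion_two_iff_schanuelTwo`); by Kirby 2010 Prop. 7.2 (tree theorem
  `schanuelConjecture_iff_ecl_empty_holds`) the search space shrinks to tuples from the countable
  field `ecl ∅` (`crux_iff_ecl_empty`); the cheapest conceivable kill is an algebraic relation
  between `e` and `π` (`not_crux_of_not_expOnePiAlgebraicIndependent`).
* §0b RANK STRUCTURE (new, kernel-checked): `schanuelRank_of_succ : SchanuelRank (l+1) →
  SchanuelRank l` (extend `y` by an algebraic integer outside `span_ℚ(y)` — a power of a primitive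
  `p`-th root of unity, `p ≥ l+2`, `exists_isIntegral_not_mem_span` — at a cost of `≤ 1` in
  transcendence degree); hence `royCriterion_anti`, **`not_royCriterion_of_le`: COUNTEREXAMPLE RANKS
  FORM AN UP-SET**, and `crux_iff_frequently` / `crux_iff_eventually`: "Roy's criterion for
  infinitely many (resp. all large) ranks" is NOT a weakening of the crux — no rank can be skipped,
  and a disproof at rank `l` is a disproof at every rank `≥ l`.
* §0c SHAPE OF A FIRST COUNTEREXAMPLE: `schanuelRank_of_isAlgebraic` (Lindemann–Weierstrass layer,
  tree theorem `algebraicIndependent_exp_holds`) ⇒ `exists_transcendental_of_counterexample` (some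
  coordinate of a counterexample is transcendental); `trdeg_eq_of_first_failure` (at the first
  failing rank `l+1` the defect is exactly one: `trdeg ℚ(y, e^y) = l`).
  **`crux_iff_reduced`** packages §0–§0c: crux ⟺ Schanuel's inequality for `ℚ`-free tuples of
  rank `≥ 2` from `ecl ∅` with a transcendental coordinate. In ROY'S format a counterexample lies on
  the torsion graph (`torsion_of_royHypothesis`: `αⱼ^d = e^{d yⱼ}` for all `j`), i.e. it is a
  Schanuel counterexample `D·y` of the same rank in disguise.
* §0d KILL MENU (`not_crux_of_…`): any ONE of — an algebraic relation among `ℚ`-free logarithms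
  of algebraic numbers, between `π` and `log 2`, between `e` and `e^e`, or the algebraicity of
  `e^e`, `2^{log 2}`, `e^{π²}` (all printed as open) — refutes the crux (tree consequences of
  Schanuel composed with `crux_imp_schanuelRank`).
* §1 LOAD-BEARING HYPOTHESES of `RoyCriterion l` (`theorem crux_false_without_…`):
  `LinearIndependent ℚ y` (witness `l = 1`, `y = 0`, `α = 1`: the tree's own auxiliary polynomials
  `royHypothesis_exp'` satisfy the hypothesis at `(0, 1)`), and it cannot be weakened to
  "`y` injective with non-zero entries" (witness `l = 2`, `y = (1, 2)`, `α = (e, e²)`,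
  `trdeg ℚ(e) ≤ 1`); `∀ j, α j ≠ 0` (witness `l = 1`, `y = 1`, `α = 0`, `P_N = X₁ · Q_N` with `Q_N`
  the auxiliary polynomial at `(0,1)`: INTEGRALITY forces EXACT vanishing `(D^k Q_N)(0,1) = 0`,
  `k ≤ N^{s₀}`, and `D^k(X₁ Q) = X₁ (1 + D)^k Q` kills every point `(m, 0^m)`); `P ≠ 0`
  (trivially: `crux_false_without_P_ne_zero`, `P_N = 0` at `(1,1)`). NOT settled cheaply: the
  height bound `≤ e^N` (without it the values at an algebraic point lie in an order like `ℤ[√2]`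
  and can be small only through lattice effects — neither a construction nor a Liouville-type
  proof is cheap) and the per-parameter sharpness of the window (§3).
  NON-VACUITY BOTH WAYS: the hypothesis holds on the graph of `exp` at every `y`
  (`royHypothesis_exp'`, tree) and FAILS at the algebraic point `(1, 2)` for every admissible
  window (`not_royHypothesis_one_two`: Roy's Thm 1 `(b) ⇒ (a)` + Hermite, both tree theorems).
* §2 NATURAL STRENGTHENINGS REFUTED: the conclusion cannot be raised to `l + 1 ≤ trdeg`
  (`not_cruxSucc`, witness `l = 1`, `y = 1`, `α = e`: `trdeg ℚ(1, e) ≤ 1`) — the crux is sharp in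
  rank one. CALIBRATION OF THE DERIVATIVE EXPONENT
  (`royCriterion_false_with_derivative_exponent_lt_one`): decouple the derivative range `k ≤ N^s`
  from the window parameter `s₀`; for EVERY `0 ≤ s < 1` the statement is FALSE (window with
  `t₁ > s`, algebraic point `(1,1)`, `P_N = (X₁−1)^{⌊N^s⌋+1}`, `royHypothesis_one_one`), while the
  UPPER side kernel-checked: `royCriterion_derivExp_of_schanuelRank` (under `SchanuelRank l`, TRUE
  for every `s` with `max{1,t₀,2t₁} < min{s,2s₁} < u`, via `Roy2001_prop3_holds`) and
  `royCriterion_one_derivExp` (rank one, UNCONDITIONAL); the crux sits at `s = s₀` inside the true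
  range — the honest threshold for `s` lies in `[t₁, max{1,t₀,2t₁}]`; calibration, not a threat.
* TWIN FILE. The rfl-twin crux `RoyThesis` (item `stmt-Schanuel-0078`, `crux_eq_twin`) has its own
  standing adversary file IN TREE, `Summits/Schanuel/Schanuel/Cruxes/RoyThesis/Disproof.lean`
  (published 02:37Z, before this one), with overlapping §1-type lemmas and, beyond this file,
  KERNEL-CHECKED window facts: `crux_false_without_W1` (the inequality `max(1,t₀,2t₁) < min(s₀,2s₁)`
  IS load-bearing) and `cruxWideWindow_iff_schanuel` (the `u`-inequalities beyond Theorem 1's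
  window are NOT: the wide-window crux is still ⟺ Schanuel), plus `royHypothesis_one_iff` /
  `rankOne_decided` and a no-derivative variant. Read both files; what is prose in §3 (i) below is a
  theorem there.
* §3 WINDOW / UNIFORMITY NOTES (prose; what the tree's proofs actually use). (i) The direction
  `SchanuelRank l → RoyCriterion l` uses of the window (1) only `max{1,t₀,2t₁} < s₀`, `t₁ ≤ s₁`,
  `2t₁ < u` (docstring of `RoyCriterionProp3Proofs.lean`), so the constraints
  `max{s₀, s₁+t₁} < u < (1+t₀+t₁)/2` and `1 < 2s₁` are NOT load-bearing for truth — they make the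
  hypothesis satisfiable on the graph of `exp` (`exists_royAuxPoly`), i.e. they carry the converse;
  a prover may take `(h : hypothesis-with-relaxed-window)` variants as "possibly unnecessary
  hypotheses". (ii) NO DIRICHLET HANDLE: in Roy's format the number of unknown coefficients
  `N^{t₀+t₁}` is always BELOW the number of conditions `N^{s₀+s₁}` (`t₀ < s₀`, `t₁ < s₁` are in the
  window), so — unlike the one-point crux `RoySmallValueDirichletGap`, where the box principle gives
  the hypothesis at every point below the edge — the box principle never produces the hypothesis
  here; the hypothesis is a genuine COHERENCE condition across the `N^{s₁}` translates, which is what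
  Roy's Theorem 1 converts into "`αe^{−y}` is torsion". THE `1` IN `max{1, t₀, 2t₁}` IS THE
  LOG-HEIGHT EXPONENT: with height `≤ e^{N^h}` in place of `e^N`, the Schwarz-lemma step of
  `prop3_core` needs `N^{s₀}` vanishing orders to beat `N^h`, so the true side plausibly reads
  `max{h, t₀, 2t₁} < min{s₀, 2s₁}` (the tree's `prop3_core` is stated for `h = 1` only; not
  generalised here); on the false side, dropping the height bound is NOT cheaply refutable: at an
  algebraic point the values `D^kP(my, α^m)` lie in an order (`ℤ`, `ℤ[1/2]`, `ℤ[√2]`, …) — at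
  integral or `S`-integral points integrality forces exact vanishing, impossible since unknowns
  `N^{t₀+t₁}` < conditions; at irrational algebraic points smallness needs a nearly degenerate
  value lattice, and the Liouville-type lower bound for its shortest vector
  (`≈ e^{−N^{t₀+t₁+max(s₀,s₁+t₁)}}`) is far below the required `e^{−N^u}`, so neither side closes.
  Per-parameter sharpness of the window in Theorem 1 is not claimed in print and is research-level;
  parked. (iii) `∃ᶠ N` VARIANT (hypothesis
  for infinitely many `N` only): the tree's `prop3_core` refutes the hypothesis at EVERY scale `M` at
  which the powers `βʲ`, `j ≤ M^{t₁}`, of `β = αe^{−y}` stay `M^{−κ}`-away from `1` (any `κ > 0`);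
  Roy's Lemma 4 supplies such scales only infinitely often, whence the printed `∀ᶠ`. For an
  ALGEBRAIC pair `(y, α)` (the only pairs at which the rank-1 conclusion fails) with `|β| = 1`,
  `β = e^{2πia}`, a bound `‖ja‖ ≥ j^{−μ}` for all `j` would make every large scale good, i.e. would
  prove the `∃ᶠ`-variant of `RoyCriterion 1` TRUE; that bound is Baker's INHOMOGENEOUS theorem for
  `j log α − jy − 2pπi` (algebraic constant term `−jy`), not in the tree (the tree's
  `baker_wustholz` is homogeneous). Dually the natural counterexample mechanism (ultra-Liouville `a`,
  perturbing the torsion construction of Prop. 2 at the good-approximation scales) needs exactly the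
  violations Baker excludes. So: no cheap kill of the `∃ᶠ` variant, and in rank one it is TRUE modulo
  inhomogeneous Baker — uniformity in `N` is NOT load-bearing here (contrast: for crux #2 the `∃ᶠ`
  variant IS false, `RoySmallValueDirichletGap/Negative/FrequentlyFalse.lean`, because there the
  point may be transcendental).
* `-- Targets`: none (payload `stuck_stubs = []`).
* `-- Near-misses / open mutations`: `FrequentlyVariantRankOne` (uniformity in `N`): PROVED off the
  circle `|αe^{−y}| = 1` (`not_frequently_conditionB_of_norm_ne_one`,
  `frequentlyVariantRankOne_of_norm_ne_one` — the `∃ᶠ` hypothesis already fails there at every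
  large scale) and TRUE IN FULL MODULO BAKER (`frequentlyVariantRankOne_of_baker`, from the inline
  hypothesis `BakerArgIrrationalityMeasure`; so uniformity in `N` is NOT load-bearing in rank one —
  a would-be refuter gains nothing from sparse scales); `NoHeightVariantRankOne`
  (height bound deleted; undetermined) stated WITHOUT claim; `eventuallyVariantRankOne_holds` is the
  sanity check that the un-mutated rank-one statement in the same format is a tree theorem.
* WHY IT RESISTS (bottom docblock).

LANDED (importable by lines, ideators, provers): def-free copies of §1–§2 in
`Summits/Schanuel/Schanuel/Theorems/RoyThesisTyped/Negative/LoadBearingHypotheses.lean` (p76509: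
`royCriterion_false_without_alphaNeZero`, `royCriterion_false_without_linearIndependent`,
`royCriterion_false_with_injective_for_linearIndependent`, `not_royCriterion_succ`, and the tools
`RoyThesisTyped.iterate_royD_X_one_mul`, `RoyThesisTyped.eventually_exact_zeros`,
`RoyThesisTyped.royHypothesis_one_zero`, …); ALSO LANDED (all ACCEPTED 2026-08-16):
`…/Negative/RankStructure.lean` (p80702: §0b–§0c + `RoyThesisTyped.crux_iff_reduced`,
`RoyThesisTyped.schanuelRank_of_succ`, `RoyThesisTyped.not_royCriterion_of_le`, …),
`…/Negative/DerivativeExponent.lean` (p80785: §2 calibration, both sides: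
`royCriterion_false_with_derivative_exponent_lt_one`,
`RoyThesisTyped.royCriterion_derivExp_of_schanuelRank`, `RoyThesisTyped.royCriterion_one_derivExp`)
and `…/Negative/UniformityCalibration.lean` (p80846: `RoyThesisTyped.not_royHypothesis_one_two`,
the `∃ᶠ N` mutation off/on the circle, `RoyThesisTyped.frequentlyVariantRankOne_of_baker`).
Import them as `Summits.Schanuel.Schanuel.Theorems.RoyThesisTyped.Negative.<Name>`.
COMPUTE: kit job `j011417` (PSLQ exclusion
bounds for integer relations among monomials of degree ≤ 6 (≤ 8 for `(e, π)`) in the rank-2 pairs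
`(e,π)`, `(e,e^e)`, `(log 2, 2^{√2})`, `(π, log 2)`, `(log 2, log 3)`; evidence attached to the item
on completion).
-/

set_option linter.dupNamespace false

noncomputable section

namespace Summit.Schanuel.Schanuel.Cruxes.RoyThesisTyped.Disproof

open MvPolynomial Filter Complex
open Literature.NumberTheory.Transcendental
open Summit.Schanuel.Schanuel.Theses.RoyCriterion (RoyThesisTyped RoyThesis SchanuelTwo)
open Summit.Schanuel.Schanuel.Theorems.RoySmallValueDirichletGapTauCount
  (aeval_iterate_royD_pow_eq_zero X_one_sub_one_ne_zero mvPolyHeight_pow_X_one_sub_one_le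
   totalDegree_pow_X_one_sub_one_le eventually_nat_mul_rpow_le_rpow)

/-! ## §0 Read-back and reductions -/

/-- The body of the crux. [folklore] -/
theorem crux_iff : RoyThesisTyped ↔ ∀ n, RoyCriterion n := Iff.rfl

/-- The crux and its untyped twin `RoyThesis` (item `stmt-Schanuel-0078`) are the same term.
[folklore] -/
theorem crux_eq_twin : RoyThesisTyped = RoyThesis := rfl

/-- **Crux ⟺ summit.** Both directions are kernel theorems in tree (`Roy2001_iff_holds`: Roy 2001
§5, with the auxiliary polynomial `exists_royAuxPoly` for `→` and Proposition 3 for `←`).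
[cite: Roy2001, §5 (pp. 193–194)] -/
theorem crux_iff_summit : RoyThesisTyped ↔ _root_.Schanuel :=
  ⟨fun h n => (Roy2001_iff_holds n).mp (h n), fun h n => (Roy2001_iff_holds n).mpr (h n)⟩

/-- Rank by rank. [cite: Roy2001, §5] -/
theorem royCriterion_iff_schanuelRank (l : ℕ) : RoyCriterion l ↔ SchanuelRank l :=
  Roy2001_iff_holds l

/-- **What a disproof must exhibit**: a `ℚ`-linearly independent tuple `y` with
`trdeg_ℚ ℚ(y, e^y) < l` — nothing about polynomials, heights or the window survives the
equivalence. [folklore] -/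
theorem not_crux_iff_exists_counterexample :
    ¬ RoyThesisTyped ↔ ∃ (l : ℕ) (y : Fin l → ℂ), LinearIndependent ℚ y ∧
      Algebra.trdeg ℚ ↥(IntermediateField.adjoin ℚ (Set.range y ∪ Set.range (cexp ∘ y))) < l := by
  rw [not_congr crux_iff_summit]
  simp only [_root_.Schanuel, Literature.Periods.SchanuelConjecture, not_forall, not_le, exists_prop]

/-- Rank `0` holds (tree). [folklore] -/
theorem crux_rank_zero : RoyCriterion 0 := royCriterion_zero

/-- Rank `1` holds (tree: Roy's equivalence + Hermite–Lindemann, both kernel theorems).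
[cite: Roy2001, §1 (p. 184: the case l = 1 is Hermite–Lindemann)] -/
theorem crux_rank_one : RoyCriterion 1 :=
  Literature.Transcend.royCriterion_one_of_facts Roy2001_iff_holds transcendental_exp_holds

/-- **A counterexample has rank at least two.** [folklore] -/
theorem two_le_of_not_royCriterion {l : ℕ} (h : ¬ RoyCriterion l) : 2 ≤ l := by
  rcases Nat.lt_or_ge l 2 with hl | hl
  · interval_cases l
    · exact absurd crux_rank_zero h
    · exact absurd crux_rank_one h
  · exact hl

/-- The crux is its own restriction to ranks `≥ 2`. [folklore] -/
theorem crux_iff_forall_two_le : RoyThesisTyped ↔ ∀ l, 2 ≤ l → RoyCriterion l :=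
  ⟨fun h l _ => h l, fun h l => by
    by_contra hc
    exact hc (h l (two_le_of_not_royCriterion hc))⟩

/-- The first open rung of the crux is the route's crux #3 `SchanuelTwo` (item `stmt-Schanuel-0069`).
[cite: Roy2001, §1] -/
theorem royCriterion_two_iff_schanuelTwo : RoyCriterion 2 ↔ SchanuelTwo := by
  rw [Roy2001_iff_holds 2]
  simp only [SchanuelRank, SchanuelTwo, Nat.cast_ofNat]

/-- A failure of Schanuel in any single rank kills the crux. [folklore] -/
theorem not_crux_of_not_schanuelRank {l : ℕ} (h : ¬ SchanuelRank l) : ¬ RoyThesisTyped :=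
  fun hX => h ((Roy2001_iff_holds l).mp (hX l))

/-- **The cheapest conceivable kill**: an algebraic relation between `e` and `π` (Roy 2001, p. 183:
"including the algebraic independence of `e` and `π` (take `y₁ = 1` and `y₂ = πi`)") refutes the
crux (tree: `Literature.Barriers.Schanuel.expOnePiAlgebraicIndependent_of_schanuel`).
[cite: Roy2001, §1 p. 183] -/
theorem not_crux_of_not_expOnePiAlgebraicIndependent (h : ¬ ExpOnePiAlgebraicIndependent) :
    ¬ RoyThesisTyped := fun hX =>
  h (Literature.Barriers.Schanuel.expOnePiAlgebraicIndependent_of_schanuel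
    fun n => (Roy2001_iff_holds n).mp (hX n))

/-- **Search space = tuples from `ecl ∅`** (Kirby 2010 Prop. 7.2, tree theorem
`schanuelConjecture_iff_ecl_empty_holds`): the crux holds iff Roy's/Schanuel's inequality holds for
`ℚ`-linearly independent tuples drawn from the countable field `ecl ∅` of exponentially-algebraic
numbers; so every counterexample contains an essential one inside `ecl ∅`.
[cite: Kirby2010, Prop. 7.2 and §1] -/
theorem crux_iff_ecl_empty : RoyThesisTyped ↔
    ∀ (n : ℕ) (x : Fin n → ℂ), (∀ i, x i ∈ ecl (∅ : Set ℂ)) → LinearIndependent ℚ x →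
      (n : Cardinal) ≤ Algebra.trdeg ℚ
        ↥(IntermediateField.adjoin ℚ (Set.range x ∪ Set.range (Complex.exp ∘ x))) :=
  crux_iff_summit.trans schanuelConjecture_iff_ecl_empty_holds

/-! ## §0b Rank structure: counterexample ranks form an up-set -/

/-- **Algebraic numbers escape every finite-dimensional `ℚ`-subspace of `ℂ`**: for `y : Fin l → ℂ`
there is an algebraic integer `c ∉ span_ℚ(y)` — a power `ζ^i` of a primitive `p`-th root of unity
with `p ≥ l + 2` prime (the `p − 1` powers `ζ^i`, `i < p − 1`, are `ℚ`-linearly independent by the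
irreducibility of the cyclotomic polynomial). [folklore] -/
theorem exists_isIntegral_not_mem_span {l : ℕ} (y : Fin l → ℂ) :
    ∃ c : ℂ, IsIntegral ℚ c ∧ c ∉ Submodule.span ℚ (Set.range y) := by
  obtain ⟨p, hp, hprime⟩ := Nat.exists_infinite_primes (l + 2)
  have hp0 : p ≠ 0 := hprime.ne_zero
  set ζ : ℂ := cexp (2 * Real.pi * I / p) with hζ
  have hprim : IsPrimitiveRoot ζ p := Complex.isPrimitiveRoot_exp p hp0
  have hint : IsIntegral ℚ ζ := (hprim.isIntegral hprime.pos).tower_top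
  have hdeg : (minpoly ℚ ζ).natDegree = p - 1 := by
    rw [← Polynomial.cyclotomic_eq_minpoly_rat hprim hprime.pos, Polynomial.natDegree_cyclotomic,
      Nat.totient_prime hprime]
  have hli := linearIndependent_pow (K := ℚ) ζ
  by_contra hall
  set W : Submodule ℚ ℂ := Submodule.span ℚ (Set.range y) with hW
  have hall' : ∀ c : ℂ, IsIntegral ℚ c → c ∈ W := fun c hc' =>
    not_not.mp fun hn => hall ⟨c, hc', hn⟩
  have hmem : ∀ i : Fin (minpoly ℚ ζ).natDegree, ζ ^ (i : ℕ) ∈ W := fun i => hall' _ (hint.pow _)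
  let g : Fin (minpoly ℚ ζ).natDegree → W := fun i => ⟨ζ ^ (i : ℕ), hmem i⟩
  have hg : LinearIndependent ℚ g := LinearIndependent.of_comp W.subtype hli
  haveI : Module.Finite ℚ W := FiniteDimensional.span_of_finite ℚ (Set.finite_range y)
  have hcard := hg.fintype_card_le_finrank
  have hWl : Module.finrank ℚ W ≤ l := by
    have := finrank_range_le_card (R := ℚ) y
    simpa [Set.finrank] using this
  rw [Fintype.card_fin, hdeg] at hcard
  omega

/-- **Schanuel ranks are downward hereditary** (equivalently: COUNTEREXAMPLE RANKS FORM AN UP-SET):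
`SchanuelRank (l + 1) → SchanuelRank l`. Given `y` linearly independent of rank `l`, extend it by an
algebraic `c ∉ span_ℚ(y)` (`exists_isIntegral_not_mem_span`); then
`trdeg ℚ(y, c, e^y, e^c) ≤ trdeg ℚ(y, e^y) + 1` (`c` costs nothing, `e^c` at most one), so rank
`l + 1` for the extended tuple gives rank `l` for `y`. [folklore] -/
theorem schanuelRank_of_succ {l : ℕ} (h : SchanuelRank (l + 1)) : SchanuelRank l := by
  intro y hy
  obtain ⟨c, hc, hcW⟩ := exists_isIntegral_not_mem_span y
  have hy' : LinearIndependent ℚ (Fin.cons c y : Fin (l + 1) → ℂ) :=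
    linearIndependent_finCons.mpr ⟨hy, hcW⟩
  have h1 := h (Fin.cons c y) hy'
  set S : Set ℂ := Set.range y ∪ Set.range (cexp ∘ y) with hS
  have hle : IntermediateField.adjoin ℚ (Set.range (Fin.cons c y : Fin (l + 1) → ℂ) ∪
      Set.range (cexp ∘ (Fin.cons c y : Fin (l + 1) → ℂ))) ≤
      IntermediateField.adjoin ℚ ((S ∪ {cexp c}) ∪ {c}) := by
    apply IntermediateField.adjoin.mono
    rintro x (⟨i, rfl⟩ | ⟨i, rfl⟩)
    · refine Fin.cases ?_ (fun j => ?_) i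
      · simp
      · simp [hS]
    · refine Fin.cases ?_ (fun j => ?_) i
      · simp
      · simp [hS]
  have halg : ∀ x ∈ ({c} : Set ℂ), IsAlgebraic ℚ x := by
    rintro x rfl
    exact hc.isAlgebraic
  have hone : Algebra.trdeg ℚ ↥(IntermediateField.adjoin ℚ ({cexp c} : Set ℂ)) ≤ 1 := by
    have := trdeg_adjoin_le_mk (F := ℚ) ({cexp c} : Set ℂ)
    rwa [Cardinal.mk_singleton] at this
  have key : Algebra.trdeg ℚ ↥(IntermediateField.adjoin ℚ ((S ∪ {cexp c}) ∪ {c})) ≤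
      Algebra.trdeg ℚ ↥(IntermediateField.adjoin ℚ S) + 1 := by
    calc Algebra.trdeg ℚ ↥(IntermediateField.adjoin ℚ ((S ∪ {cexp c}) ∪ {c}))
        = Algebra.trdeg ℚ ↥(IntermediateField.adjoin ℚ (S ∪ {cexp c})) :=
          Literature.Barriers.Schanuel.trdeg_adjoin_union_eq_of_isAlgebraic (S ∪ {cexp c}) {c} halg
      _ ≤ Algebra.trdeg ℚ ↥(IntermediateField.adjoin ℚ S) +
            Algebra.trdeg ℚ ↥(IntermediateField.adjoin ℚ ({cexp c} : Set ℂ)) :=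
          trdeg_adjoin_union_le S {cexp c}
      _ ≤ Algebra.trdeg ℚ ↥(IntermediateField.adjoin ℚ S) + 1 := add_le_add (le_refl _) hone
  have := (h1.trans (trdeg_le_of_injective (IntermediateField.inclusion hle)
    (IntermediateField.inclusion_injective hle))).trans key
  push_cast at this
  exact Cardinal.add_one_le_add_one_iff.mp this

/-- Antitonicity in the rank. [folklore] -/
theorem schanuelRank_anti {l l' : ℕ} (hll : l ≤ l') (h : SchanuelRank l') :
    SchanuelRank l := by
  induction hll with
  | refl => exact h
  | step _ ih => exact ih (schanuelRank_of_succ h)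

/-- **Roy's criterion is downward hereditary in the rank** (through Roy's equivalence, a kernel
theorem in tree). [cite: Roy2001, §5] -/
theorem royCriterion_anti {l l' : ℕ} (hll : l ≤ l') (h : RoyCriterion l') :
    RoyCriterion l :=
  (Roy2001_iff_holds l).mpr (schanuelRank_anti hll ((Roy2001_iff_holds l').mp h))

/-- **Counterexample ranks form an up-set**: a failure of Roy's criterion at rank `l` is a failure at
every rank `l' ≥ l`. [folklore] -/
theorem not_royCriterion_of_le {l l' : ℕ} (hll : l ≤ l') (h : ¬ RoyCriterion l) :
    ¬ RoyCriterion l' :=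
  fun h' => h (royCriterion_anti hll h')

/-- **The crux equals its own tail**: "Roy's criterion for infinitely many ranks" is NOT a weakening.
[folklore] -/
theorem crux_iff_frequently :
    RoyThesisTyped ↔ ∃ᶠ l in atTop, RoyCriterion l := by
  constructor
  · exact fun h => Frequently.of_forall h
  · intro h l
    obtain ⟨l', hl', h'⟩ := Filter.frequently_atTop.mp h l
    exact royCriterion_anti hl' h'

/-- … and equals its eventual version. [folklore] -/
theorem crux_iff_eventually :
    RoyThesisTyped ↔ ∀ᶠ l in atTop, RoyCriterion l :=
  ⟨fun h => Eventually.of_forall h,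
    fun h => crux_iff_frequently.mpr h.frequently⟩


/-! ## §0c Shape of a first counterexample -/

/-- **Lindemann–Weierstrass layer** (tree theorem `algebraicIndependent_exp_holds`): Schanuel's
inequality holds for every `ℚ`-free tuple of ALGEBRAIC numbers, in every rank. [cite: BakerTNT1975, Ch. 1 Thm 1.4] -/
theorem schanuelRank_of_isAlgebraic {l : ℕ} (y : Fin l → ℂ)
    (halg : ∀ j, IsAlgebraic ℚ (y j)) (hy : LinearIndependent ℚ y) :
    (l : Cardinal) ≤ Algebra.trdeg ℚ
      ↥(IntermediateField.adjoin ℚ (Set.range y ∪ Set.range (cexp ∘ y))) := by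
  have hE : AlgebraicIndependent ℚ fun j => cexp (y j) := algebraicIndependent_exp_holds y halg hy
  set K := IntermediateField.adjoin ℚ (Set.range y ∪ Set.range (cexp ∘ y)) with hK
  let f : Fin l → K := fun j => ⟨cexp (y j), IntermediateField.subset_adjoin _ _ (Or.inr ⟨j, rfl⟩)⟩
  have hf : AlgebraicIndependent ℚ f := AlgebraicIndependent.of_comp K.val hE
  simpa using hf.cardinalMk_le_trdeg

/-- **A counterexample has a transcendental coordinate** (contrapositive of the
Lindemann–Weierstrass layer): if `y` is `ℚ`-free with `trdeg ℚ(y, e^y) < l` then some `y j` is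
transcendental. [cite: BakerTNT1975, Ch. 1 Thm 1.4] -/
theorem exists_transcendental_of_counterexample {l : ℕ} {y : Fin l → ℂ}
    (hy : LinearIndependent ℚ y)
    (hlt : Algebra.trdeg ℚ ↥(IntermediateField.adjoin ℚ (Set.range y ∪ Set.range (cexp ∘ y))) < l) :
    ∃ j, Transcendental ℚ (y j) := by
  by_contra h
  have h' : ∀ j, IsAlgebraic ℚ (y j) := fun j => not_not.mp (not_exists.mp h j)
  exact (not_le.mpr hlt) (schanuelRank_of_isAlgebraic y h' hy)

/-- **At the first failing rank the defect is exactly one**: if Schanuel holds in rank `l` and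
`y : Fin (l+1) → ℂ` is a `ℚ`-free counterexample in rank `l + 1`, then `trdeg ℚ(y, e^y) = l`
(the sub-tuple `y ∘ Fin.succ` already contributes `l`). [folklore] -/
theorem trdeg_eq_of_first_failure {l : ℕ} (hl : SchanuelRank l) {y : Fin (l + 1) → ℂ}
    (hy : LinearIndependent ℚ y)
    (hlt : Algebra.trdeg ℚ ↥(IntermediateField.adjoin ℚ (Set.range y ∪ Set.range (cexp ∘ y))) <
      (l + 1 : ℕ)) :
    Algebra.trdeg ℚ ↥(IntermediateField.adjoin ℚ (Set.range y ∪ Set.range (cexp ∘ y))) = l := by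
  have hsub : LinearIndependent ℚ (y ∘ Fin.succ) := hy.comp _ (Fin.succ_injective _)
  have h1 := hl (y ∘ Fin.succ) hsub
  have hle : IntermediateField.adjoin ℚ (Set.range (y ∘ Fin.succ) ∪ Set.range (cexp ∘ (y ∘ Fin.succ))) ≤
      IntermediateField.adjoin ℚ (Set.range y ∪ Set.range (cexp ∘ y)) := by
    apply IntermediateField.adjoin.mono
    rintro x (⟨i, rfl⟩ | ⟨i, rfl⟩)
    · exact Or.inl ⟨i.succ, rfl⟩
    · exact Or.inr ⟨i.succ, rfl⟩
  have hge := h1.trans (trdeg_le_of_injective (IntermediateField.inclusion hle)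
    (IntermediateField.inclusion_injective hle))
  refine le_antisymm ?_ hge
  have : Algebra.trdeg ℚ ↥(IntermediateField.adjoin ℚ (Set.range y ∪ Set.range (cexp ∘ y))) <
      Order.succ (l : Cardinal) := by
    rw [Cardinal.succ_natCast]; exact_mod_cast hlt
  exact Order.lt_succ_iff.mp this


/-- **Shape of a counterexample in ROY'S format: it lies on the torsion graph.** If `α ∈ (ℂˣ)ˡ`
and the small-value hypothesis holds in an admissible window, then every `αⱼ` is a torsion
translate of `e^{yⱼ}`: `αⱼ^d = e^{d yⱼ}` for some `d ≥ 1` (Roy's Theorem 1 `(b) ⇒ (a)` coordinate by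
coordinate, tree theorems `royThm1BtoA_holds` + `royConditionB_of_royHypothesis`). So a
counterexample `(y, α)` to `RoyCriterion l` is a Schanuel counterexample `D·y` of the same rank in
disguise (`D = ∏ dⱼ`; this is Roy 2001 §5, 1° read backwards) — suggested for this file by triager
r1-2 (`TRIAGE-r1-2.md`, note (★)). [cite: Roy2001, Thm. 1 and §5 (1°)] -/
theorem torsion_of_royHypothesis {l : ℕ} {y α : Fin l → ℂ} (hα : ∀ j, α j ≠ 0)
    {s₀ s₁ t₀ t₁ u : ℝ} (hadm : RoyAdmissible s₀ s₁ t₀ t₁ u) (hhyp : RoyHypothesis y α s₀ s₁ t₀ t₁ u) :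
    ∀ j, ∃ d : ℕ, 1 ≤ d ∧ α j ^ d = cexp (d * y j) := fun j =>
  royThm1BtoA_holds (y j) (α j) (hα j) s₀ s₁ t₀ t₁ u hadm (royConditionB_of_royHypothesis hhyp j)

/-! ## §0d Kill menu — each hypothesis below is printed as OPEN; any one of them refutes the crux
(tree consequences of `∀ n, SchanuelRank n`, composed with Roy's equivalence). -/

/-- The crux gives Schanuel in every rank. [cite: Roy2001, §5] -/
theorem crux_imp_schanuelRank (hX : RoyThesisTyped) : ∀ n, SchanuelRank n :=
  fun n => (Roy2001_iff_holds n).mp (hX n)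

/-- Kill 1: algebraically DEPENDENT `ℚ`-free logarithms of algebraic numbers (the conjecture on
algebraic independence of logarithms fails) ⇒ ¬crux. [cite: Pila2022, Ch. 13 (after Thm 13.4)] -/
theorem not_crux_of_not_algIndepLogarithms (h : ¬ Literature.Barriers.Schanuel.AlgIndepLogarithms) :
    ¬ RoyThesisTyped :=
  fun hX => h (Literature.Barriers.Schanuel.algIndepLogarithms_of_schanuel (crux_imp_schanuelRank hX))

/-- Kill 2: an algebraic relation between `π` and `log 2` ⇒ ¬crux. [cite: Roy1992, Introduction p. 22] -/
theorem not_crux_of_not_piI_logTwo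
    (h : ¬ AlgebraicIndependent ℚ ![(Real.pi : ℂ) * I, (Real.log 2 : ℂ)]) : ¬ RoyThesisTyped :=
  fun hX => h (Literature.Barriers.Schanuel.algebraicIndependent_piI_log_two_of_schanuel
    (crux_imp_schanuelRank hX))

/-- Kill 3: an algebraic relation between `e` and `e^e` ⇒ ¬crux. [cite: Rivoal2024, §5 p. 226] -/
theorem not_crux_of_not_exp_expExp (h : ¬ AlgebraicIndependent ℚ ![cexp 1, cexp (cexp 1)]) :
    ¬ RoyThesisTyped :=
  fun hX => h (Literature.Barriers.Schanuel.algebraicIndependent_exp_expExp_of_schanuel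
    (crux_imp_schanuelRank hX))

/-- Kill 4: `e^e` algebraic ⇒ ¬crux. [cite: Rivoal2024, §5 p. 226] -/
theorem not_crux_of_isAlgebraic_exp_exp (h : IsAlgebraic ℚ (Real.exp (Real.exp 1))) :
    ¬ RoyThesisTyped :=
  fun hX => Literature.Barriers.Schanuel.transcendental_exp_exp_of_schanuel (crux_imp_schanuelRank hX) h

/-- Kill 5: `2^{log 2}` algebraic ⇒ ¬crux. [cite: Waldschmidt2005Periodes, §8.1 Exemple 26] -/
theorem not_crux_of_isAlgebraic_two_rpow_log_two (h : IsAlgebraic ℚ ((2 : ℝ) ^ Real.log 2)) :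
    ¬ RoyThesisTyped :=
  fun hX => Literature.Barriers.Schanuel.transcendental_two_rpow_log_two_of_schanuel
    (crux_imp_schanuelRank hX) h

/-- Kill 6: `e^{π²}` algebraic ⇒ ¬crux. [cite: Waldschmidt2005Periodes, §8.1 Exemple 26] -/
theorem not_crux_of_isAlgebraic_exp_pi_sq (h : IsAlgebraic ℚ (Real.exp (Real.pi ^ 2))) :
    ¬ RoyThesisTyped :=
  fun hX => Literature.Barriers.Schanuel.transcendental_exp_pi_sq_of_schanuel
    (crux_imp_schanuelRank hX) h

/-- **THE REDUCED CRUX** (all of §0–§0c in one statement): the crux is equivalent to Schanuel's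
inequality for `ℚ`-free tuples of rank `≥ 2`, drawn from the countable field `ecl ∅`, with at
least one transcendental coordinate. This is exactly what a disproof must violate and what a proof
may assume. [folklore] -/
theorem crux_iff_reduced : RoyThesisTyped ↔
    ∀ (n : ℕ), 2 ≤ n → ∀ (x : Fin n → ℂ), (∀ i, x i ∈ ecl (∅ : Set ℂ)) →
      (∃ i, Transcendental ℚ (x i)) → LinearIndependent ℚ x →
        (n : Cardinal) ≤ Algebra.trdeg ℚ
          ↥(IntermediateField.adjoin ℚ (Set.range x ∪ Set.range (Complex.exp ∘ x))) := by
  rw [crux_iff_ecl_empty]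
  constructor
  · exact fun h n _ x hx _ hli => h n x hx hli
  · intro h n x hx hli
    by_cases hn : n < 2
    · have hS : SchanuelRank n := by
        interval_cases n
        · exact schanuelRank_zero
        · exact (Roy2001_iff_holds 1).mp crux_rank_one
      exact hS x hli
    · by_cases halg : ∀ i, IsAlgebraic ℚ (x i)
      · exact schanuelRank_of_isAlgebraic x halg hli
      · obtain ⟨i, hi⟩ := not_forall.mp halg
        exact h n (by omega) x hx ⟨i, hi⟩ hli

/-! ## §1 Load-bearing hypotheses -/

/-! ### Tools: `X₁`-multiples and exact vanishing at `(0, 1)` -/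

/-- `D^j` is additive. [folklore] -/
theorem iterate_royD_add (j : ℕ) (P Q : MvPolynomial (Fin 2) ℤ) :
    royD^[j] (P + Q) = royD^[j] P + royD^[j] Q := by
  induction j generalizing P Q with
  | zero => rfl
  | succ j ih => rw [Function.iterate_succ_apply, royD_add, ih]; rfl

/-- `D^k (X₁ · P) = X₁ · (1 + D)^k P` (since `D X₁ = X₁`). [folklore] -/
theorem iterate_royD_X_one_mul (k : ℕ) (P : MvPolynomial (Fin 2) ℤ) :
    royD^[k] (X 1 * P) = X 1 * (fun R => R + royD R)^[k] P := by
  induction k generalizing P with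
  | zero => rfl
  | succ k ih =>
    rw [Function.iterate_succ_apply, Function.iterate_succ_apply, royD_mul, royD_X_one]
    have hx : (X 1 * P + X 1 * royD P : MvPolynomial (Fin 2) ℤ) = X 1 * (P + royD P) := by ring
    rw [hx, ih]

/-- If `(D^j P)(0,1) = 0` for `j ≤ n + 1` then `(D^j (P + D P))(0,1) = 0` for `j ≤ n`. [folklore] -/
theorem taylorInt_add_royD_eq_zero {P : MvPolynomial (Fin 2) ℤ} {n : ℕ}
    (h : ∀ j ≤ n + 1, taylorInt j P = 0) : ∀ j ≤ n, taylorInt j (P + royD P) = 0 := by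
  intro j hj
  have h1 := h j (by omega)
  have h2 := h (j + 1) (by omega)
  simp only [taylorInt] at h1 h2 ⊢
  rw [iterate_royD_add, map_add, h1, zero_add]
  rwa [Function.iterate_succ_apply] at h2

/-- If `(D^j P)(0,1) = 0` for `j ≤ n` then `((1 + D)^k P)(0,1) = 0` for `k ≤ n`. [folklore] -/
theorem eval_iterate_idAddRoyD_eq_zero :
    ∀ (k n : ℕ) (P : MvPolynomial (Fin 2) ℤ), (∀ j ≤ n, taylorInt j P = 0) → k ≤ n →
      eval ![0, 1] ((fun R => R + royD R)^[k] P) = 0 := by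
  intro k
  induction k with
  | zero => intro n P h _; simpa [taylorInt] using h 0 (Nat.zero_le _)
  | succ k ih =>
    intro n P h hk
    obtain ⟨n, rfl⟩ : ∃ n', n = n' + 1 := ⟨n - 1, by omega⟩
    rw [Function.iterate_succ_apply]
    exact ih n (P + royD P) (taylorInt_add_royD_eq_zero h) (by omega)

/-- Exact vanishing of `D^k (X₁ P)` at `(0, 1)` for `k ≤ n`, given `(D^j P)(0,1) = 0`, `j ≤ n`.
[folklore] -/
theorem aeval_iterate_royD_X_one_mul_zero_one {P : MvPolynomial (Fin 2) ℤ} {n k : ℕ}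
    (h : ∀ j ≤ n, taylorInt j P = 0) (hk : k ≤ n) :
    aeval ![(0 : ℂ), 1] (royD^[k] (X 1 * P)) = 0 := by
  have hint : eval ![(0 : ℤ), 1] (royD^[k] (X 1 * P)) = 0 := by
    rw [iterate_royD_X_one_mul, map_mul, eval_iterate_idAddRoyD_eq_zero k n P h hk, mul_zero]
  have hc := intCast_eval ![0, 1] (royD^[k] (X 1 * P))
  rw [hint, Int.cast_zero] at hc
  have hpt : (fun i => ((![0, 1] : Fin 2 → ℤ) i : ℂ)) = ![(0 : ℂ), 1] := by
    ext i; fin_cases i <;> simp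
  rw [hpt] at hc
  exact hc.symm

/-- `D^k (X₁ P)` vanishes identically on the line `X₁ = 0`. [folklore] -/
theorem aeval_iterate_royD_X_one_mul_at_zero (P : MvPolynomial (Fin 2) ℤ) (k : ℕ) (a : ℂ) :
    aeval ![a, 0] (royD^[k] (X 1 * P)) = 0 := by
  rw [iterate_royD_X_one_mul, map_mul, aeval_X]
  simp

/-- INTEGRALITY: a value `(D^j P)(0,1) ∈ ℤ` of norm `< 1` is `0`. [folklore] -/
theorem taylorInt_eq_zero_of_norm_lt_one {P : MvPolynomial (Fin 2) ℤ} {j : ℕ}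
    (h : ‖aeval ![(0 : ℂ), 1] (royD^[j] P)‖ < 1) : taylorInt j P = 0 := by
  have hc : (taylorInt j P : ℂ) = aeval ![(0 : ℂ), 1] (royD^[j] P) := by
    rw [taylorInt, intCast_eval]
    congr 1
    ext i; fin_cases i <;> simp
  rw [← hc, Complex.norm_intCast] at h
  have h' : |taylorInt j P| < 1 := by exact_mod_cast h
  exact Int.abs_lt_one_iff.mp h'

/-- Multiplying by `X₁` does not raise the height. [folklore] -/
theorem mvPolyHeight_X_mul_le (P : MvPolynomial (Fin 2) ℤ) :
    mvPolyHeight (X 1 * P) ≤ mvPolyHeight P := by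
  classical
  refine Finset.sup_le fun m _ => ?_
  rw [coeff_X_mul']
  split_ifs
  · exact natAbs_coeff_le_mvPolyHeight P _
  · simp

/-- `deg_{X₀} (X₁ P) ≤ deg_{X₀} P`. [folklore] -/
theorem degreeOf_zero_X_one_mul_le (P : MvPolynomial (Fin 2) ℤ) :
    (X 1 * P).degreeOf 0 ≤ P.degreeOf 0 := by
  have h := degreeOf_mul_le 0 (X 1 : MvPolynomial (Fin 2) ℤ) P
  have hX : degreeOf 0 (X 1 : MvPolynomial (Fin 2) ℤ) = 0 := by
    rw [degreeOf_X]; simp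
  omega

/-- `deg_{X₁} (X₁ P) ≤ deg_{X₁} P + 1`. [folklore] -/
theorem degreeOf_one_X_one_mul_le (P : MvPolynomial (Fin 2) ℤ) :
    (X 1 * P).degreeOf 1 ≤ P.degreeOf 1 + 1 := by
  have h := degreeOf_mul_le 1 (X 1 : MvPolynomial (Fin 2) ℤ) P
  have hX : degreeOf 1 (X 1 : MvPolynomial (Fin 2) ℤ) = 1 := by
    rw [degreeOf_X]; simp
  omega

/-- Auxiliary admissible parameters with `t₁` slightly lowered (room for the factor `X₁`).
[cite: Roy2001, §1 (1)] -/
theorem royAdmissible_aux : RoyAdmissible 1.3 0.7 1.2 0.49 1.32 := by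
  refine ⟨by norm_num, by norm_num, by norm_num, by norm_num, by norm_num, ?_, ?_, by norm_num⟩ <;>
    norm_num

/-- **Exact zeros at `(0, 1)`.** For admissible parameters and all large `N` there is
`0 ≠ P_N ∈ ℤ[X₀, X₁]` with `deg_{X₀} ≤ N^{t₀}`, `deg_{X₁} ≤ N^{t₁}`, height `≤ e^N` and
`(D^j P_N)(0, 1) = 0` EXACTLY for all `j ≤ N^{s₀}`: the tree's auxiliary polynomials at `y = 0`
(`royHypothesis_exp'`) have integer values at `(0,1)` of norm `≤ e^{-N^u} < 1`. [folklore] -/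
theorem eventually_exact_zeros {s₀ s₁ t₀ t₁ u : ℝ} (hadm : RoyAdmissible s₀ s₁ t₀ t₁ u) :
    ∀ᶠ N : ℕ in atTop, ∃ P : MvPolynomial (Fin 2) ℤ, P ≠ 0 ∧
      (P.degreeOf 0 : ℝ) ≤ (N : ℝ) ^ t₀ ∧ (P.degreeOf 1 : ℝ) ≤ (N : ℝ) ^ t₁ ∧
      (mvPolyHeight P : ℝ) ≤ Real.exp N ∧
      ∀ j : ℕ, (j : ℝ) ≤ (N : ℝ) ^ s₀ → taylorInt j P = 0 := by
  have hu : 0 < u := hadm.2.2.2.2.1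
  have h := royHypothesis_exp' (l := 1) ![(0 : ℂ)] hadm
  filter_upwards [h, eventually_gt_atTop 0] with N hN hN0
  obtain ⟨P, hP0, hd0, hd1, hH, hval⟩ := hN
  refine ⟨P, hP0, hd0, hd1, hH, fun j hj => ?_⟩
  have hv := hval j (fun _ => 0) hj
    (fun _ => by simpa using Real.rpow_nonneg (Nat.cast_nonneg N) s₁)
  simp only [Nat.cast_zero, zero_mul, Finset.sum_const_zero, pow_zero, Finset.prod_const_one]
    at hv
  refine taylorInt_eq_zero_of_norm_lt_one (lt_of_le_of_lt hv ?_)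
  rw [Real.exp_lt_one_iff]
  have : (0 : ℝ) < (N : ℝ) ^ u := Real.rpow_pos_of_pos (by exact_mod_cast hN0) u
  linarith

/-! ### `∀ j, α j ≠ 0` is load-bearing -/

/-- The crux with the hypothesis `∀ j, α j ≠ 0` deleted (verbatim otherwise). [folklore] -/
def CruxWithoutAlphaNeZero : Prop :=
  ∀ (l : ℕ) (y α : Fin l → ℂ), LinearIndependent ℚ y →
    ∀ (s₀ s₁ t₀ t₁ u : ℝ), RoyAdmissible s₀ s₁ t₀ t₁ u → RoyHypothesis y α s₀ s₁ t₀ t₁ u →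
      (l : Cardinal) ≤ Algebra.trdeg ℚ ↥(IntermediateField.adjoin ℚ (Set.range y ∪ Set.range α))

/-- **The hypothesis of Conjecture 2 HOLDS at `(y, α) = (1, 0)`** (rank one, parameters
`(1.3, 0.7, 1.2, 0.5, 1.32)`): `P_N = X₁ Q_N` with `Q_N` the exact-zero polynomial of
`eventually_exact_zeros` (parameters with `t₁ = 0.49`); at `m = 0` the point is `(0, 0⁰) = (0, 1)`
where `D^k (X₁ Q_N) = X₁ (1+D)^k Q_N` vanishes for `k ≤ N^{1.3}`, at `m ≥ 1` the point `(m, 0)` lies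
on the `D`-invariant line `X₁ = 0`. [folklore] -/
theorem royHypothesis_one_zero : RoyHypothesis ![(1 : ℂ)] ![(0 : ℂ)] 1.3 0.7 1.2 0.5 1.32 := by
  have hgrow : ∀ᶠ N : ℕ in atTop, (N : ℝ) ^ (0.49 : ℝ) + 1 ≤ (N : ℝ) ^ (0.5 : ℝ) := by
    have h1 := eventually_mul_rpow_le_mul_rpow (2 : ℝ) (a := 0.49) (b := 0.5) (D := 1)
      (by norm_num) one_pos
    filter_upwards [tendsto_natCast_atTop_atTop.eventually h1, eventually_ge_atTop 1]
      with N hN hN1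
    have hx1 : (1 : ℝ) ≤ (N : ℝ) ^ (0.49 : ℝ) := Real.one_le_rpow (by exact_mod_cast hN1) (by norm_num)
    linarith
  unfold RoyHypothesis
  filter_upwards [eventually_exact_zeros royAdmissible_aux, hgrow] with N hN hNg
  obtain ⟨P, hP0, hd0, hd1, hH, hzero⟩ := hN
  refine ⟨X 1 * P, mul_ne_zero (X_ne_zero _) hP0, ?_, ?_, ?_, ?_⟩
  · exact le_trans (by exact_mod_cast degreeOf_zero_X_one_mul_le P) hd0
  · calc (((X 1 * P).degreeOf 1 : ℕ) : ℝ) ≤ (P.degreeOf 1 : ℝ) + 1 := by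
          exact_mod_cast degreeOf_one_X_one_mul_le P
      _ ≤ (N : ℝ) ^ (0.49 : ℝ) + 1 := by linarith
      _ ≤ (N : ℝ) ^ (0.5 : ℝ) := hNg
  · exact le_trans (by exact_mod_cast mvPolyHeight_X_mul_le P) hH
  · intro k m hk hm
    have hpt : (![∑ j, (m j : ℂ) * (![(1 : ℂ)] : Fin 1 → ℂ) j,
        ∏ j, (![(0 : ℂ)] : Fin 1 → ℂ) j ^ m j] : Fin 2 → ℂ) = ![(m 0 : ℂ), (0 : ℂ) ^ (m 0)] := by
      rw [Fin.sum_univ_one, Fin.prod_univ_one]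
      simp
    rw [hpt]
    rcases Nat.eq_zero_or_pos (m 0) with h0 | hpos
    · rw [h0, pow_zero, Nat.cast_zero,
        aeval_iterate_royD_X_one_mul_zero_one (n := ⌊(N : ℝ) ^ (1.3 : ℝ)⌋₊) ?_ (Nat.le_floor hk),
        norm_zero]
      · exact (Real.exp_pos _).le
      · intro j hj
        exact hzero j ((Nat.cast_le.mpr hj).trans (Nat.floor_le (Real.rpow_nonneg (Nat.cast_nonneg N) _)))
    · rw [zero_pow hpos.ne', aeval_iterate_royD_X_one_mul_at_zero, norm_zero]
      exact (Real.exp_pos _).le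

/-- `ℚ(1, 0)` is algebraic: transcendence degree `0`. [folklore] -/
theorem isAlgebraic_adjoin_one_zero :
    Algebra.IsAlgebraic ℚ ↥(IntermediateField.adjoin ℚ
      (Set.range (![(1 : ℂ)] : Fin 1 → ℂ) ∪ Set.range (![(0 : ℂ)] : Fin 1 → ℂ))) := by
  apply IntermediateField.isAlgebraic_adjoin
  rintro x (⟨i, rfl⟩ | ⟨i, rfl⟩)
  · fin_cases i; simpa using isIntegral_one
  · fin_cases i; simpa using isIntegral_zero

/-- **`∀ j, α j ≠ 0` is load-bearing**: the crux with that side condition deleted is FALSE —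
witness `l = 1`, `y = 1`, `α = 0` (so `trdeg ℚ(1, 0) = 0 < 1`) with the polynomials of
`royHypothesis_one_zero`. [cite: Roy2001, Conjecture 2 (the hypothesis α ∈ (ℂˣ)ˡ)] -/
theorem crux_false_without_alphaNeZero : ¬ CruxWithoutAlphaNeZero := by
  intro h
  have hli : LinearIndependent ℚ (![(1 : ℂ)] : Fin 1 → ℂ) := linearIndependent_unique_iff.mpr (by simp)
  have hcon := h 1 ![1] ![0] hli 1.3 0.7 1.2 0.5 1.32 royAdmissible_example royHypothesis_one_zero
  haveI := isAlgebraic_adjoin_one_zero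
  rw [trdeg_eq_zero] at hcon
  simp at hcon

/-! ### `LinearIndependent ℚ y` is load-bearing -/

/-- The crux with `LinearIndependent ℚ y` deleted (verbatim otherwise). [folklore] -/
def CruxWithoutLinearIndependent : Prop :=
  ∀ (l : ℕ) (y α : Fin l → ℂ), (∀ j, α j ≠ 0) →
    ∀ (s₀ s₁ t₀ t₁ u : ℝ), RoyAdmissible s₀ s₁ t₀ t₁ u → RoyHypothesis y α s₀ s₁ t₀ t₁ u →
      (l : Cardinal) ≤ Algebra.trdeg ℚ ↥(IntermediateField.adjoin ℚ (Set.range y ∪ Set.range α))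

/-- **`LinearIndependent ℚ y` is load-bearing**: deleted, the crux is FALSE — witness `l = 1`,
`y = 0`, `α = e⁰ = 1`: the hypothesis holds on the graph of `exp` at ANY `y`
(`royHypothesis_exp'`, the tree's Thue–Siegel auxiliary polynomial), and `trdeg ℚ(0, 1) = 0`.
[cite: Roy2001, Conjecture 2 (the hypothesis "linearly independent over ℚ")] -/
theorem crux_false_without_linearIndependent : ¬ CruxWithoutLinearIndependent := by
  intro h
  have hyp := royHypothesis_exp' (l := 1) ![(0 : ℂ)] royAdmissible_example
  have hcon := h 1 ![0] (cexp ∘ ![0]) (fun j => Complex.exp_ne_zero _) _ _ _ _ _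
    royAdmissible_example hyp
  haveI : Algebra.IsAlgebraic ℚ ↥(IntermediateField.adjoin ℚ
      (Set.range (![(0 : ℂ)] : Fin 1 → ℂ) ∪ Set.range (cexp ∘ (![(0 : ℂ)] : Fin 1 → ℂ)))) := by
    apply IntermediateField.isAlgebraic_adjoin
    rintro x (⟨i, rfl⟩ | ⟨i, rfl⟩)
    · fin_cases i; simpa using isIntegral_zero
    · fin_cases i; simpa using isIntegral_one
  rw [trdeg_eq_zero] at hcon
  simp at hcon

/-- The crux with `LinearIndependent ℚ y` weakened to "`y` injective with non-zero entries".
[folklore] -/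
def CruxWithInjectiveForLinearIndependent : Prop :=
  ∀ (l : ℕ) (y α : Fin l → ℂ), Function.Injective y → (∀ j, y j ≠ 0) → (∀ j, α j ≠ 0) →
    ∀ (s₀ s₁ t₀ t₁ u : ℝ), RoyAdmissible s₀ s₁ t₀ t₁ u → RoyHypothesis y α s₀ s₁ t₀ t₁ u →
      (l : Cardinal) ≤ Algebra.trdeg ℚ ↥(IntermediateField.adjoin ℚ (Set.range y ∪ Set.range α))

/-- `trdeg_ℚ ℚ(e) ≤ 1`. [folklore] -/
theorem trdeg_adjoin_exp_one_le_one :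
    Algebra.trdeg ℚ ↥(IntermediateField.adjoin ℚ ({cexp 1} : Set ℂ)) ≤ 1 := by
  have h := trdeg_adjoin_le_mk (F := ℚ) ({cexp 1} : Set ℂ)
  rwa [Cardinal.mk_singleton] at h

/-- **Linear independence cannot be weakened to injectivity**: witness `l = 2`, `y = (1, 2)`,
`α = (e, e²)` — the hypothesis holds (`royHypothesis_exp'`), `y` is injective with non-zero
entries, but `ℚ(1, 2, e, e²) ⊆ ℚ(e)` has transcendence degree `≤ 1 < 2`.
[cite: Roy2001, Conjecture 2] -/
theorem crux_false_with_injective_for_linearIndependent :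
    ¬ CruxWithInjectiveForLinearIndependent := by
  intro h
  have hyp := royHypothesis_exp' (l := 2) ![(1 : ℂ), 2] royAdmissible_example
  have hinj : Function.Injective (![(1 : ℂ), 2] : Fin 2 → ℂ) := by
    intro i j hij
    fin_cases i <;> fin_cases j
    · rfl
    · exfalso; norm_num at hij
    · exfalso; norm_num at hij
    · rfl
  have hne : ∀ j, (![(1 : ℂ), 2] : Fin 2 → ℂ) j ≠ 0 := by
    intro j; fin_cases j <;> simp
  have hcon := h 2 ![1, 2] (cexp ∘ ![1, 2]) hinj hne (fun j => Complex.exp_ne_zero _) _ _ _ _ _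
    royAdmissible_example hyp
  have hle : IntermediateField.adjoin ℚ (Set.range (![(1 : ℂ), 2] : Fin 2 → ℂ) ∪
      Set.range (cexp ∘ (![(1 : ℂ), 2] : Fin 2 → ℂ))) ≤
      IntermediateField.adjoin ℚ ({cexp 1} : Set ℂ) := by
    rw [IntermediateField.adjoin_le_iff]
    have he : cexp 1 ∈ IntermediateField.adjoin ℚ ({cexp 1} : Set ℂ) :=
      IntermediateField.subset_adjoin ℚ _ rfl
    rintro x (⟨i, rfl⟩ | ⟨i, rfl⟩) <;> fin_cases i
    · simp
    · simp
    · simpa using he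
    · have h2 : cexp 2 = cexp 1 ^ 2 := by
        rw [← Complex.exp_nat_mul]; norm_num
      simpa [h2] using pow_mem he 2
  have := (hcon.trans (trdeg_le_of_injective (IntermediateField.inclusion hle)
    (IntermediateField.inclusion_injective hle))).trans trdeg_adjoin_exp_one_le_one
  have h21 : (2 : ℕ) ≤ 1 := by exact_mod_cast this
  omega

/-! ## §2 Natural strengthenings refuted -/

/-- The crux with the conclusion raised by one: `l + 1 ≤ trdeg ℚ(y, α)`. [folklore] -/
def CruxSucc : Prop :=
  ∀ (l : ℕ) (y α : Fin l → ℂ), LinearIndependent ℚ y → (∀ j, α j ≠ 0) →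
    ∀ (s₀ s₁ t₀ t₁ u : ℝ), RoyAdmissible s₀ s₁ t₀ t₁ u → RoyHypothesis y α s₀ s₁ t₀ t₁ u →
      (l + 1 : Cardinal) ≤ Algebra.trdeg ℚ ↥(IntermediateField.adjoin ℚ (Set.range y ∪ Set.range α))

/-- **The conclusion is sharp in rank one**: `CruxSucc` is FALSE — witness `l = 1`, `y = 1`,
`α = e`: the hypothesis holds (`royHypothesis_exp'`) and `trdeg ℚ(1, e) ≤ 1 < 2`. (At rank `l` the
analogous witness is `y = (log 2, log 3, …, log p_l)`, `α = (2, 3, …, p_l)`, `trdeg ≤ l`; not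
formalised.) [folklore] -/
theorem not_cruxSucc : ¬ CruxSucc := by
  intro h
  have hyp := royHypothesis_exp' (l := 1) ![(1 : ℂ)] royAdmissible_example
  have hli : LinearIndependent ℚ (![(1 : ℂ)] : Fin 1 → ℂ) := linearIndependent_unique_iff.mpr (by simp)
  have hcon := h 1 ![1] (cexp ∘ ![1]) hli (fun j => Complex.exp_ne_zero _) _ _ _ _ _
    royAdmissible_example hyp
  have hle : IntermediateField.adjoin ℚ (Set.range (![(1 : ℂ)] : Fin 1 → ℂ) ∪
      Set.range (cexp ∘ (![(1 : ℂ)] : Fin 1 → ℂ))) ≤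
      IntermediateField.adjoin ℚ ({cexp 1} : Set ℂ) := by
    rw [IntermediateField.adjoin_le_iff]
    rintro x (⟨i, rfl⟩ | ⟨i, rfl⟩) <;> fin_cases i
    · simp
    · simpa using IntermediateField.subset_adjoin ℚ ({cexp 1} : Set ℂ) rfl
  have := (hcon.trans (trdeg_le_of_injective (IntermediateField.inclusion hle)
    (IntermediateField.inclusion_injective hle))).trans trdeg_adjoin_exp_one_le_one
  have h21 : (1 + 1 : ℕ) ≤ 1 := by exact_mod_cast this
  omega

/-! ### Calibration of the derivative exponent -/

/-- `deg_{X₀} (X₁ − 1)ⁿ = 0`. [folklore] -/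
theorem degreeOf_zero_pow_X_one_sub_one (n : ℕ) :
    ((X 1 - 1 : MvPolynomial (Fin 2) ℤ) ^ n).degreeOf 0 = 0 := by
  have h1 : (X 1 - 1 : MvPolynomial (Fin 2) ℤ).degreeOf 0 = 0 := by
    have := degreeOf_sub_le 0 (X 1 : MvPolynomial (Fin 2) ℤ) 1
    rw [degreeOf_X, degreeOf_one] at this
    simpa using this
  have := degreeOf_pow_le 0 (X 1 - 1 : MvPolynomial (Fin 2) ℤ) n
  rw [h1, mul_zero] at this
  exact Nat.le_zero.mp this

/-- **The small-value hypothesis with derivative exponent `s` (`k ≤ N^s`), `0 ≤ s < min(t₁, 1)`,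
HOLDS at the algebraic point `(y, α) = (1, 1)`**, for any `s₁, t₀, u`: `P_N = (X₁ − 1)^{⌊N^s⌋+1}`
has `X₀`-degree `0`, `X₁`-degree `≤ 2N^s ≤ N^{t₁}`, height `≤ 2^{⌊N^s⌋+1} ≤ e^N`, and
`D^k P_N` vanishes on the line `X₁ = 1 ∋ (m, 1^m)` for `k ≤ N^s` (exact multiplicity).
[folklore] -/
theorem royHypothesis_one_one {s s₁ t₀ t₁ u : ℝ} (hs0 : 0 ≤ s) (hst : s < t₁)
    (hs1 : s < 1) : RoyHypothesis ![(1 : ℂ)] ![(1 : ℂ)] s s₁ t₀ t₁ u := by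
  unfold RoyHypothesis
  filter_upwards [eventually_nat_mul_rpow_le_rpow 2 hst, eventually_nat_mul_rpow_le_rpow 2 hs1,
    eventually_ge_atTop 1] with N h1 h2 hN1
  set n : ℕ := ⌊(N : ℝ) ^ s⌋₊ + 1 with hn
  have hnle : (n : ℝ) ≤ 2 * (N : ℝ) ^ s := by
    have hx1 : (1 : ℝ) ≤ (N : ℝ) := by exact_mod_cast hN1
    have hNs1 : (1 : ℝ) ≤ (N : ℝ) ^ s := Real.one_le_rpow hx1 hs0
    have hfl := Nat.floor_le (Real.rpow_nonneg (Nat.cast_nonneg N) s)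
    rw [hn]; push_cast; linarith
  have hnN : (n : ℝ) ≤ N := by
    rw [Real.rpow_one] at h2
    linarith [h2]
  refine ⟨(X 1 - 1) ^ n, pow_ne_zero _ X_one_sub_one_ne_zero, ?_, ?_, ?_, ?_⟩
  · rw [degreeOf_zero_pow_X_one_sub_one]
    simpa using Real.rpow_nonneg (Nat.cast_nonneg N) t₀
  · calc ((((X 1 - 1 : MvPolynomial (Fin 2) ℤ) ^ n).degreeOf 1 : ℕ) : ℝ) ≤ n := by
          exact_mod_cast (degreeOf_le_totalDegree _ _).trans (totalDegree_pow_X_one_sub_one_le n)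
      _ ≤ 2 * (N : ℝ) ^ s := hnle
      _ ≤ (N : ℝ) ^ t₁ := h1
  · have h2e : (2 : ℝ) ≤ Real.exp 1 := by
      have := Real.add_one_le_exp (1 : ℝ); norm_num at this ⊢; linarith
    calc ((mvPolyHeight ((X 1 - 1 : MvPolynomial (Fin 2) ℤ) ^ n) : ℕ) : ℝ) ≤ (2 : ℝ) ^ n := by
          exact_mod_cast mvPolyHeight_pow_X_one_sub_one_le n
      _ ≤ (Real.exp 1) ^ n := pow_le_pow_left₀ (by norm_num) h2e n
      _ = Real.exp n := by rw [← Real.exp_nat_mul, mul_one]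
      _ ≤ Real.exp N := Real.exp_le_exp.mpr hnN
  · intro k m hk hm
    have hpt : (![∑ j, (m j : ℂ) * (![(1 : ℂ)] : Fin 1 → ℂ) j,
        ∏ j, (![(1 : ℂ)] : Fin 1 → ℂ) j ^ m j] : Fin 2 → ℂ) = ![(m 0 : ℂ), 1] := by
      rw [Fin.sum_univ_one, Fin.prod_univ_one]; simp
    rw [hpt]
    have hkn : k < n := by
      rw [hn]; exact Nat.lt_succ_of_le (Nat.le_floor hk)
    rw [aeval_iterate_royD_pow_eq_zero _ hkn, norm_zero]
    exact (Real.exp_pos _).le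

/-- `ℚ(1, 1)` is algebraic. [folklore] -/
theorem isAlgebraic_adjoin_one_one :
    Algebra.IsAlgebraic ℚ ↥(IntermediateField.adjoin ℚ
      (Set.range (![(1 : ℂ)] : Fin 1 → ℂ) ∪ Set.range (![(1 : ℂ)] : Fin 1 → ℂ))) := by
  apply IntermediateField.isAlgebraic_adjoin
  rintro x (⟨i, rfl⟩ | ⟨i, rfl⟩) <;> fin_cases i <;> simpa using isIntegral_one

/-- **CALIBRATION OF THE DERIVATIVE EXPONENT.** Replace, in the hypothesis of `RoyCriterion l` only,
the derivative range `k ≤ N^{s₀}` by `k ≤ N^{s}` for a fixed exponent `s` (the window (1) for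
`(s₀, s₁, t₀, t₁, u)` untouched; the crux is the coupled case `s = s₀ > max{1, t₀, 2t₁}`). For
EVERY `0 ≤ s < 1` the resulting statement is FALSE: choose an admissible window with `t₁ > s`
(possible exactly because admissible `t₁` fill `(0, 1)`) and the algebraic point `(1, 1)` of
`royHypothesis_one_one`. So a proof must use derivatives of order beyond `N^{t₁}` (multiplicity)
and beyond the log-height scale `N` — both built into `s₀ > max{1, 2t₁}`; by the tree's proof of
Roy's Proposition 3 the decoupled statement is TRUE (given Schanuel) as soon as
`s > max{1, t₀, 2t₁}`, so this calibrates, and does not threaten, the crux.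
[cite: Roy2001, §1 (1) and Prop. 3] -/
theorem royCriterion_false_with_derivative_exponent_lt_one {s : ℝ} (hs0 : 0 ≤ s) (hs1 : s < 1) :
    ¬ (∀ (l : ℕ) (y α : Fin l → ℂ), LinearIndependent ℚ y → (∀ j, α j ≠ 0) →
      ∀ (s₀ s₁ t₀ t₁ u : ℝ), RoyAdmissible s₀ s₁ t₀ t₁ u → RoyHypothesis y α s s₁ t₀ t₁ u →
        (l : Cardinal) ≤ Algebra.trdeg ℚ
          ↥(IntermediateField.adjoin ℚ (Set.range y ∪ Set.range α))) := by
  intro h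
  have hli : LinearIndependent ℚ (![(1 : ℂ)] : Fin 1 → ℂ) :=
    linearIndependent_unique_iff.mpr (by simp)
  haveI := isAlgebraic_adjoin_one_one
  rcases lt_or_ge s (3 / 4) with hs | hs
  · -- fixed window (1.55, 0.8, 1.5, 0.75, 1.6), t₁ = 0.75 > s
    have hadm : RoyAdmissible 1.55 0.8 1.5 0.75 1.6 := by
      refine ⟨by norm_num, by norm_num, by norm_num, by norm_num, by norm_num, ?_, ?_, by norm_num⟩ <;>
        norm_num
    have hcon := h 1 ![1] ![1] hli (by simp) _ _ _ _ _ hadm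
      (royHypothesis_one_one hs0 (by norm_num; linarith) hs1)
    rw [trdeg_eq_zero] at hcon
    simp at hcon
  · -- window (2b+ε, b+ε, 2b, b, 2b+2ε), b = (s+1)/2 ∈ [7/8, 1), ε = (1−b)/5
    set b : ℝ := (s + 1) / 2 with hb
    set ε : ℝ := (1 - b) / 5 with hε
    have hb1 : b < 1 := by rw [hb]; linarith
    have hb0 : 7 / 8 ≤ b := by rw [hb]; linarith
    have hε0 : 0 < ε := by rw [hε]; linarith
    have hadm : RoyAdmissible (2 * b + ε) (b + ε) (2 * b) b (2 * b + 2 * ε) := by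
      refine ⟨by linarith, by linarith, by linarith, by linarith, by linarith, ?_, ?_, ?_⟩
      · refine max_lt (lt_min (by linarith) (by linarith))
          (max_lt (lt_min (by linarith) (by linarith)) (lt_min (by linarith) (by linarith)))
      · exact max_lt (by linarith) (by linarith)
      · rw [hε]; linarith
    have hcon := h 1 ![1] ![1] hli (by simp) _ _ _ _ _ hadm
      (royHypothesis_one_one hs0 (by rw [hb]; linarith) hs1)
    rw [trdeg_eq_zero] at hcon
    simp at hcon


/-- **Upper side of the derivative-exponent calibration.** With the derivative range decoupled
(`k ≤ N^s`) and only Roy's Proposition-3 inequalities `max{1, t₀, 2t₁} < min{s, 2s₁} < u` on the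
parameters (no upper constraint on `u`, no `max{s, s₁+t₁} < u`), Schanuel in rank `l` already gives
the decoupled criterion in rank `l`: Proposition 3 (tree theorem `Roy2001_prop3_holds`) makes every
`αⱼ e^{−yⱼ}` torsion, and the scaling argument of Roy 2001 §5, 1° concludes.
[cite: Roy2001, Prop. 3 and §5 (1°)] -/
theorem royCriterion_derivExp_of_schanuelRank {l : ℕ} (hS : SchanuelRank l)
    (y α : Fin l → ℂ) (hy : LinearIndependent ℚ y) (hα : ∀ j, α j ≠ 0)
    {s s₁ t₀ t₁ u : ℝ} (hs : 0 < s) (hs₁ : 0 < s₁) (ht₀ : 0 < t₀) (ht₁ : 0 < t₁) (hu : 0 < u)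
    (h1 : max 1 (max t₀ (2 * t₁)) < min s (2 * s₁)) (h2 : min s (2 * s₁) < u)
    (hhyp : RoyHypothesis y α s s₁ t₀ t₁ u) :
    (l : Cardinal) ≤ Algebra.trdeg ℚ ↥(IntermediateField.adjoin ℚ (Set.range y ∪ Set.range α)) := by
  have hd : ∀ j, RoyConditionA (y j) (α j) := fun j => by
    by_contra hna
    exact Roy2001_prop3_holds (y j) (α j) (hα j) s s₁ t₀ t₁ u hs hs₁ ht₀ ht₁ hu h1 h2 hna
      (royConditionB_of_royHypothesis hhyp j)
  choose d hd1 hd2 using hd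
  set D : ℕ := ∏ j, d j with hD
  have hD0 : 0 < D := Finset.prod_pos fun j _ => hd1 j
  have hαD : ∀ j, α j ^ D = cexp (D * y j) := by
    intro j
    obtain ⟨e, he⟩ : d j ∣ D := Finset.dvd_prod_of_mem _ (Finset.mem_univ j)
    rw [he, pow_mul, hd2 j, ← Complex.exp_nat_mul]
    push_cast; ring_nf
  set y' : Fin l → ℂ := fun j => (D : ℂ) * y j with hy'_def
  have hy' : LinearIndependent ℚ y' := by
    have hDq : (D : ℚ) ≠ 0 := by exact_mod_cast hD0.ne'
    have := hy.units_smul (fun _ => Units.mk0 (D : ℚ) hDq)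
    convert this using 1
    ext j
    simp [hy'_def, Units.smul_def, Rat.smul_def]
  have hle : IntermediateField.adjoin ℚ (Set.range y' ∪ Set.range (cexp ∘ y')) ≤
      IntermediateField.adjoin ℚ (Set.range y ∪ Set.range α) := by
    refine IntermediateField.adjoin_le_iff.mpr ?_
    rintro x (⟨j, rfl⟩ | ⟨j, rfl⟩)
    · exact mul_mem (natCast_mem _ D)
        (IntermediateField.subset_adjoin _ _ (Or.inl ⟨j, rfl⟩))
    · change cexp ((D : ℂ) * y j) ∈ _
      rw [← hαD j]
      exact pow_mem (IntermediateField.subset_adjoin ℚ (Set.range y ∪ Set.range α)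
        (Or.inr ⟨j, rfl⟩)) D
  calc (l : Cardinal)
      ≤ Algebra.trdeg ℚ ↥(IntermediateField.adjoin ℚ (Set.range y' ∪ Set.range (cexp ∘ y'))) :=
        hS y' hy'
    _ ≤ Algebra.trdeg ℚ ↥(IntermediateField.adjoin ℚ (Set.range y ∪ Set.range α)) :=
        trdeg_le_of_injective (IntermediateField.inclusion hle)
          (IntermediateField.inclusion_injective hle)

/-- **Rank one, unconditionally**: the decoupled criterion in rank `1` is TRUE for every derivative
exponent `s` with `max{1, t₀, 2t₁} < min{s, 2s₁} < u` (Hermite–Lindemann gives Schanuel in rank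
one, tree theorem `schanuelRank_one_of_transcendental_exp`). Together with
`royCriterion_false_with_derivative_exponent_lt_one` (FALSE for every `s < 1`, in windows with
`t₁ > s`) this brackets the honest threshold for `s` between `t₁` and `max{1, t₀, 2t₁}`.
[cite: Roy2001, Prop. 3] -/
theorem royCriterion_one_derivExp (y α : Fin 1 → ℂ) (hy : LinearIndependent ℚ y)
    (hα : ∀ j, α j ≠ 0) {s s₁ t₀ t₁ u : ℝ} (hs : 0 < s) (hs₁ : 0 < s₁) (ht₀ : 0 < t₀)
    (ht₁ : 0 < t₁) (hu : 0 < u) (h1 : max 1 (max t₀ (2 * t₁)) < min s (2 * s₁))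
    (h2 : min s (2 * s₁) < u) (hhyp : RoyHypothesis y α s s₁ t₀ t₁ u) :
    (1 : Cardinal) ≤ Algebra.trdeg ℚ ↥(IntermediateField.adjoin ℚ (Set.range y ∪ Set.range α)) := by
  have h := royCriterion_derivExp_of_schanuelRank
    (Literature.Transcend.schanuelRank_one_of_transcendental_exp transcendental_exp_holds)
    y α hy hα hs hs₁ ht₀ ht₁ hu h1 h2 hhyp
  simpa using h


/-! ### The hypothesis has teeth (non-vacuity both ways) -/

/-- **The hypothesis has teeth**: at the algebraic point `(y, α) = (1, 2)` (off every torsion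
translate of the graph of `exp`: `2^d ≠ e^d` by Hermite) Roy's small-value hypothesis FAILS for
every admissible window — Roy's Theorem 1 `(b) ⇒ (a)` (tree theorem `royThm1BtoA_holds`) plus
Hermite–Lindemann (tree theorem `transcendental_exp_holds`). So the crux's hypothesis is neither
unsatisfiable (it holds on the graph of `exp`, `royHypothesis_exp'`) nor universally satisfiable.
[cite: Roy2001, Thm. 1] -/
theorem not_royHypothesis_one_two {s₀ s₁ t₀ t₁ u : ℝ}
    (hadm : RoyAdmissible s₀ s₁ t₀ t₁ u) :
    ¬ RoyHypothesis ![(1 : ℂ)] ![(2 : ℂ)] s₀ s₁ t₀ t₁ u := by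
  intro h
  have hB : RoyConditionB 1 2 s₀ s₁ t₀ t₁ u := by
    simpa using royConditionB_of_royHypothesis h 0
  obtain ⟨d, hd1, hd⟩ := royThm1BtoA_holds 1 2 two_ne_zero s₀ s₁ t₀ t₁ u hadm hB
  rw [mul_one] at hd
  have hd0 : (d : ℂ) ≠ 0 := by exact_mod_cast (show d ≠ 0 by omega)
  have htr : Transcendental ℚ (cexp (d : ℂ)) := transcendental_exp_holds (isAlgebraic_nat d) hd0
  apply htr
  rw [← hd]
  exact (isAlgebraic_nat 2).pow d


/-! ### `P ≠ 0` is (trivially) load-bearing -/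

/-- The small-value hypothesis with `P ≠ 0` deleted. [folklore] -/
def RoyHypothesisAllowingZero {l : ℕ} (y α : Fin l → ℂ) (s₀ s₁ t₀ t₁ u : ℝ) : Prop :=
  ∀ᶠ N : ℕ in atTop, ∃ P : MvPolynomial (Fin 2) ℤ,
    (P.degreeOf 0 : ℝ) ≤ (N : ℝ) ^ t₀ ∧ (P.degreeOf 1 : ℝ) ≤ (N : ℝ) ^ t₁ ∧
    (mvPolyHeight P : ℝ) ≤ Real.exp N ∧
    ∀ (k : ℕ) (m : Fin l → ℕ), (k : ℝ) ≤ (N : ℝ) ^ s₀ → (∀ j, (m j : ℝ) ≤ (N : ℝ) ^ s₁) →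
      ‖aeval ![∑ j, (m j : ℂ) * y j, ∏ j, α j ^ m j] (royD^[k] P)‖ ≤ Real.exp (-(N : ℝ) ^ u)

/-- `P = 0` satisfies the hypothesis without `P ≠ 0`, at every point. [folklore] -/
theorem royHypothesisAllowingZero_all {l : ℕ} (y α : Fin l → ℂ) (s₀ s₁ t₀ t₁ u : ℝ) :
    RoyHypothesisAllowingZero y α s₀ s₁ t₀ t₁ u := by
  refine Eventually.of_forall fun N => ⟨0, ?_, ?_, ?_, fun k m _ _ => ?_⟩
  · simpa using Real.rpow_nonneg (Nat.cast_nonneg N) t₀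
  · simpa using Real.rpow_nonneg (Nat.cast_nonneg N) t₁
  · simp [(Real.exp_pos _).le]
  · have : royD^[k] (0 : MvPolynomial (Fin 2) ℤ) = 0 := Function.iterate_fixed royD_zero k
    rw [this, map_zero, norm_zero]
    exact (Real.exp_pos _).le

/-- **`P ≠ 0` is load-bearing** (trivially): witness `l = 1`, `y = α = 1`, `P_N = 0`. [folklore] -/
theorem crux_false_without_P_ne_zero :
    ¬ (∀ (l : ℕ) (y α : Fin l → ℂ), LinearIndependent ℚ y → (∀ j, α j ≠ 0) →
      ∀ (s₀ s₁ t₀ t₁ u : ℝ), RoyAdmissible s₀ s₁ t₀ t₁ u → RoyHypothesisAllowingZero y α s₀ s₁ t₀ t₁ u →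
        (l : Cardinal) ≤ Algebra.trdeg ℚ
          ↥(IntermediateField.adjoin ℚ (Set.range y ∪ Set.range α))) := by
  intro h
  have hli : LinearIndependent ℚ (![(1 : ℂ)] : Fin 1 → ℂ) := linearIndependent_unique_iff.mpr (by simp)
  haveI := isAlgebraic_adjoin_one_one
  have hcon := h 1 ![1] ![1] hli (by simp) _ _ _ _ _ royAdmissible_example
    (royHypothesisAllowingZero_all _ _ _ _ _ _ _)
  rw [trdeg_eq_zero] at hcon
  simp at hcon

-- Targets: none (payload `stuck_stubs = []`, `targets = []`).

-- Near-misses / open mutations (statements only — no claim is made; see §3 for the analysis).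

/-- OPEN MUTATION 1 (uniformity in `N`): Roy's criterion in rank one with the small-value hypothesis
required only for INFINITELY MANY `N`. Status: no cheap kill; PROVED below OFF the circle
`|αe^{−y}| = 1` (`frequentlyVariantRankOne_of_norm_ne_one`, unconditional: there the weakened
hypothesis already fails) and IN FULL MODULO BAKER (`frequentlyVariantRankOne_of_baker`, hypothesis
`BakerArgIrrationalityMeasure` = finite irrationality measure of `arg(αe^{−y})/2π` at algebraic
`(y, α)`, a consequence of Baker's inhomogeneous theorem, not in the tree). [folklore] -/
def FrequentlyVariantRankOne : Prop :=
  ∀ (y α : ℂ), y ≠ 0 → α ≠ 0 → ∀ (s₀ s₁ t₀ t₁ u : ℝ), RoyAdmissible s₀ s₁ t₀ t₁ u →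
    (∃ᶠ N : ℕ in atTop, ∃ Q : MvPolynomial (Fin 2) ℤ, Q ≠ 0 ∧
      (Q.degreeOf 0 : ℝ) ≤ (N : ℝ) ^ t₀ ∧ (Q.degreeOf 1 : ℝ) ≤ (N : ℝ) ^ t₁ ∧
      (mvPolyHeight Q : ℝ) ≤ Real.exp N ∧
      ∀ k m : ℕ, (k : ℝ) ≤ (N : ℝ) ^ s₀ → (m : ℝ) ≤ (N : ℝ) ^ s₁ →
        ‖aeval ![(m : ℂ) * y, α ^ m] (royD^[k] Q)‖ ≤ Real.exp (-(N : ℝ) ^ u)) →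
    Transcendental ℚ y ∨ Transcendental ℚ α

/-- **Off the circle `|α| = e^{Re y}` the small-value hypothesis fails at EVERY large scale, so even
its `∃ᶠ N` weakening fails**: for `α ≠ 0` with `|α e^{−y}| ≠ 1` and Roy's Proposition-3
inequalities `max{1, t₀, 2t₁} < min{s₀, 2s₁} < u`, there are NOT infinitely many `M` carrying a
polynomial `Q_M` as in condition (b). (The tree's `prop3_core` needs only the separation
`|βʲ − 1| ≥ | |β| − 1 | > 0`, available at every scale; Lemma 4 — the source of the printed `∀ᶠ` —
enters only when `|β| = 1`.) Hence the uniformity-in-`N` mutation of the crux (`∃ᶠ` for `∀ᶠ`) can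
only be decided ON the circle, where it is the irrationality measure of `arg(αe^{−y})/2π` that
matters (finite for algebraic `(y, α)` by Baker's inhomogeneous theorem, not in the tree).
[cite: Roy2001, Prop. 3 (case |αe^{-y}| ≠ 1)] -/
theorem not_frequently_conditionB_of_norm_ne_one {y α : ℂ} (hα : α ≠ 0)
    {s₀ s₁ t₀ t₁ u : ℝ} (hs₀ : 0 < s₀) (ht₁ : 0 < t₁) (hu : 0 < u)
    (h1 : max 1 (max t₀ (2 * t₁)) < min s₀ (2 * s₁)) (h2 : min s₀ (2 * s₁) < u)
    (hβ1 : ‖α * cexp (-y)‖ ≠ 1) :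
    ¬ ∃ᶠ M : ℕ in atTop, ∃ Q : MvPolynomial (Fin 2) ℤ, Q ≠ 0 ∧
      (Q.degreeOf 0 : ℝ) ≤ (M : ℝ) ^ t₀ ∧ (Q.degreeOf 1 : ℝ) ≤ (M : ℝ) ^ t₁ ∧
      (mvPolyHeight Q : ℝ) ≤ Real.exp M ∧
      ∀ k m : ℕ, (k : ℝ) ≤ (M : ℝ) ^ s₀ → (m : ℝ) ≤ (M : ℝ) ^ s₁ →
        ‖aeval ![(m : ℂ) * y, α ^ m] (royD^[k] Q)‖ ≤ Real.exp (-(M : ℝ) ^ u) := by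
  intro hfreq
  have hδ0 : 0 < |‖α * cexp (-y)‖ - 1| := abs_pos.2 (sub_ne_zero.2 hβ1)
  have hcore := prop3_core (y := y) hα hs₀ ht₁ hu h1 h2 (one_pos : (0 : ℝ) < 1)
  have hδev : ∀ᶠ M : ℕ in atTop, 1 ≤ |‖α * cexp (-y)‖ - 1| * (M : ℝ) ^ (1 : ℝ) :=
    tendsto_natCast_atTop_atTop.eventually (eventually_const_le_mul_rpow 1 one_pos hδ0)
  obtain ⟨M, ⟨Q, hQ, hd0, hd1, hH, hsmall⟩, hc, hδM⟩ :=
    (hfreq.and_eventually (hcore.and hδev)).exists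
  exact hc _ hδM (fun j hj _ => abs_norm_sub_one_le_norm_pow_sub_one _ hj) Q hQ hd0 hd1 hH hsmall

/-- **The `∃ᶠ N` mutation of Roy's criterion in rank one HOLDS off the circle** `|αe^{−y}| = 1`
(vacuously: the weakened hypothesis already fails there), for every admissible window.
[cite: Roy2001, Prop. 3] -/
theorem frequentlyVariantRankOne_of_norm_ne_one (y α : ℂ) (hα : α ≠ 0)
    {s₀ s₁ t₀ t₁ u : ℝ} (hadm : RoyAdmissible s₀ s₁ t₀ t₁ u) (hβ1 : ‖α * cexp (-y)‖ ≠ 1)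
    (hfreq : ∃ᶠ N : ℕ in atTop, ∃ Q : MvPolynomial (Fin 2) ℤ, Q ≠ 0 ∧
      (Q.degreeOf 0 : ℝ) ≤ (N : ℝ) ^ t₀ ∧ (Q.degreeOf 1 : ℝ) ≤ (N : ℝ) ^ t₁ ∧
      (mvPolyHeight Q : ℝ) ≤ Real.exp N ∧
      ∀ k m : ℕ, (k : ℝ) ≤ (N : ℝ) ^ s₀ → (m : ℝ) ≤ (N : ℝ) ^ s₁ →
        ‖aeval ![(m : ℂ) * y, α ^ m] (royD^[k] Q)‖ ≤ Real.exp (-(N : ℝ) ^ u)) :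
    Transcendental ℚ y ∨ Transcendental ℚ α := by
  obtain ⟨hs₀, hs₁, ht₀, ht₁, hu, h1, h2, -⟩ := hadm
  exact absurd hfreq (not_frequently_conditionB_of_norm_ne_one hα hs₀ ht₁ hu h1
    (lt_of_le_of_lt (min_le_left _ _) (lt_of_le_of_lt (le_max_left _ _) h2)) hβ1)


/-- **On the circle, a finite irrationality measure kills the `∃ᶠ` hypothesis too.** For `α ≠ 0`
with `|αe^{−y}| = 1`, write `αe^{−y} = e^{2πia}`, `a = arg(αe^{−y})/2π`. If `‖ja‖ ≥ c·j^{−μ}` for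
all `j ≥ 1` (finite irrationality measure — for ALGEBRAIC `(y, α)` this is Baker's inhomogeneous
theorem, not in the tree), then the tree's `prop3_core` applies at EVERY large scale (with
`κ = μt₁ + 1`, `δ = 4c·M^{−μt₁}`), so condition (b) fails even for infinitely many `N`.
[cite: Roy2001, Prop. 3 (proof, p. 192)] -/
theorem not_frequently_conditionB_of_irrationalityMeasure {y α : ℂ} (hα : α ≠ 0)
    {s₀ s₁ t₀ t₁ u : ℝ} (hs₀ : 0 < s₀) (ht₁ : 0 < t₁) (hu : 0 < u)
    (h1 : max 1 (max t₀ (2 * t₁)) < min s₀ (2 * s₁)) (h2 : min s₀ (2 * s₁) < u)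
    (hβ1 : ‖α * cexp (-y)‖ = 1) {c μ : ℝ} (hc : 0 < c) (hμ : 0 ≤ μ)
    (hsep : ∀ j : ℕ, 1 ≤ j →
      c * (j : ℝ) ^ (-μ) ≤ |j * (arg (α * cexp (-y)) / (2 * Real.pi)) -
        round (j * (arg (α * cexp (-y)) / (2 * Real.pi)))|) :
    ¬ ∃ᶠ M : ℕ in atTop, ∃ Q : MvPolynomial (Fin 2) ℤ, Q ≠ 0 ∧
      (Q.degreeOf 0 : ℝ) ≤ (M : ℝ) ^ t₀ ∧ (Q.degreeOf 1 : ℝ) ≤ (M : ℝ) ^ t₁ ∧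
      (mvPolyHeight Q : ℝ) ≤ Real.exp M ∧
      ∀ k m : ℕ, (k : ℝ) ≤ (M : ℝ) ^ s₀ → (m : ℝ) ≤ (M : ℝ) ^ s₁ →
        ‖aeval ![(m : ℂ) * y, α ^ m] (royD^[k] Q)‖ ≤ Real.exp (-(M : ℝ) ^ u) := by
  intro hfreq
  set β : ℂ := α * cexp (-y) with hβ
  set a : ℝ := arg β / (2 * Real.pi) with ha
  have hκ : 0 < μ * t₁ + 1 := by positivity
  have hcore := prop3_core (y := y) hα hs₀ ht₁ hu h1 h2 hκ
  have hM : ∀ᶠ M : ℕ in atTop, 1 ≤ 4 * c * (M : ℝ) ∧ (1 : ℝ) ≤ M := by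
    have H : ∀ᶠ x : ℝ in atTop, 1 ≤ 4 * c * x ∧ 1 ≤ x := by
      filter_upwards [eventually_ge_atTop (max 1 (1 / (4 * c)))] with x hx
      have hx1 : 1 ≤ x := le_trans (le_max_left _ _) hx
      have hx2 : 1 / (4 * c) ≤ x := le_trans (le_max_right _ _) hx
      refine ⟨?_, hx1⟩
      rw [div_le_iff₀ (by positivity)] at hx2
      linarith
    exact tendsto_natCast_atTop_atTop.eventually H
  obtain ⟨M, ⟨Q, hQ, hd0, hd1, hH, hsmall⟩, hc', hM1, hM2⟩ :=
    (hfreq.and_eventually (hcore.and hM)).exists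
  have hM0 : (0 : ℝ) < M := by linarith
  refine hc' (4 * c * (M : ℝ) ^ (-(μ * t₁))) ?_ ?_ Q hQ hd0 hd1 hH hsmall
  · -- `δ M^κ = 4c M ≥ 1`
    have : 4 * c * (M : ℝ) ^ (-(μ * t₁)) * (M : ℝ) ^ (μ * t₁ + 1) = 4 * c * M := by
      rw [mul_assoc, ← Real.rpow_add hM0]
      ring_nf
      rw [Real.rpow_one]
    rw [this]; exact hM1
  · intro j hj1 hjT
    -- `|β^j - 1| ≥ 4 ‖j a‖ ≥ 4 c j^{-μ} ≥ 4 c M^{-μ t₁}`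
    have hj0 : (0 : ℝ) < j := by exact_mod_cast hj1
    have hlow := hsep j hj1
    have h4 := four_mul_abs_sub_round_le ((j : ℝ) * a)
    rw [← pow_eq_exp_of_norm_eq_one hβ1 j] at h4
    have hjμ : (M : ℝ) ^ (-(μ * t₁)) ≤ (j : ℝ) ^ (-μ) := by
      -- j ≤ M^{t₁} ⇒ j^{μ} ≤ M^{μ t₁} ⇒ M^{-μ t₁} ≤ j^{-μ}
      have hjt : (j : ℝ) ^ μ ≤ ((M : ℝ) ^ t₁) ^ μ := Real.rpow_le_rpow hj0.le hjT hμ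
      rw [← Real.rpow_mul hM0.le] at hjt
      rw [Real.rpow_neg hM0.le, Real.rpow_neg hj0.le, mul_comm μ t₁]
      exact inv_anti₀ (Real.rpow_pos_of_pos hj0 μ) hjt
    calc 4 * c * (M : ℝ) ^ (-(μ * t₁)) ≤ 4 * c * (j : ℝ) ^ (-μ) := by gcongr
      _ = 4 * (c * (j : ℝ) ^ (-μ)) := by ring
      _ ≤ 4 * |(j : ℝ) * a - round ((j : ℝ) * a)| := by gcongr
      _ ≤ ‖β ^ j - 1‖ := h4


/-- HYPOTHESIS H (Baker, inhomogeneous; irrationality-measure form). For ALGEBRAIC `y ≠ 0`, `α ≠ 0`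
with `|αe^{−y}| = 1` and `αe^{−y}` not a root of unity, the real number `a = arg(αe^{−y})/2π` has a
finite irrationality measure: `‖ja‖ ≥ c·j^{−μ}` for all `j ≥ 1`. This follows from Baker's lower
bound for linear forms `β₀ + β₁ log α₁ + β₂ log α₂` with algebraic coefficients
(`2πi(ja − p) = j·Log α − j·y − 2πi·p'`, constant term `−jy`); it is NOT in the tree and is
recorded here only as the hypothesis of the conditional `frequentlyVariantRankOne_of_baker`.
[cite: BakerTNT1975, Ch. 3 Thm 3.1] -/
def BakerArgIrrationalityMeasure : Prop :=
  ∀ (y α : ℂ), IsAlgebraic ℚ y → IsAlgebraic ℚ α → y ≠ 0 → α ≠ 0 → ‖α * cexp (-y)‖ = 1 →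
    (∀ d : ℕ, 1 ≤ d → (α * cexp (-y)) ^ d ≠ 1) →
    ∃ c μ : ℝ, 0 < c ∧ 0 ≤ μ ∧ ∀ j : ℕ, 1 ≤ j →
      c * (j : ℝ) ^ (-μ) ≤ |j * (arg (α * cexp (-y)) / (2 * Real.pi)) -
        round (j * (arg (α * cexp (-y)) / (2 * Real.pi)))|

/-- **OPEN MUTATION 1 IS TRUE MODULO BAKER** (kernel-checked reduction): under
`BakerArgIrrationalityMeasure`, Roy's criterion in rank one survives the weakening of its
hypothesis from "all large `N`" to "infinitely many `N`". Off the circle this is unconditional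
(`not_frequently_conditionB_of_norm_ne_one`); on the circle the torsion case is excluded by
Hermite–Lindemann (tree theorem `transcendental_exp_holds`) and the irrationality measure feeds
`not_frequently_conditionB_of_irrationalityMeasure`. So UNIFORMITY IN `N` IS NOT LOAD-BEARING for
the rank-one criterion (contrast crux #2). [cite: Roy2001, Prop. 3] -/
theorem frequentlyVariantRankOne_of_baker (hB : BakerArgIrrationalityMeasure) :
    FrequentlyVariantRankOne := by
  intro y α hy hα s₀ s₁ t₀ t₁ u hadm hfreq
  by_contra hcon
  rw [not_or] at hcon
  have hya : IsAlgebraic ℚ y := not_not.mp hcon.1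
  have hαa : IsAlgebraic ℚ α := not_not.mp hcon.2
  obtain ⟨hs₀, hs₁, ht₀, ht₁, hu, h1, h2, -⟩ := hadm
  have h2' : min s₀ (2 * s₁) < u :=
    lt_of_le_of_lt (min_le_left _ _) (lt_of_le_of_lt (le_max_left _ _) h2)
  rcases eq_or_ne ‖α * cexp (-y)‖ 1 with hβ1 | hβ1
  · have hrou : ∀ d : ℕ, 1 ≤ d → (α * cexp (-y)) ^ d ≠ 1 := by
      intro d hd h
      obtain ⟨d', hd1', hd'⟩ := (royCondA_iff y α).2 ⟨d, hd, h⟩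
      have hd0 : ((d' : ℂ) * y) ≠ 0 := mul_ne_zero (by exact_mod_cast (show d' ≠ 0 by omega)) hy
      exact transcendental_exp_holds ((isAlgebraic_nat d').mul hya) hd0 (hd' ▸ hαa.pow d')
    obtain ⟨c, μ, hc, hμ, hsep⟩ := hB y α hya hαa hy hα hβ1 hrou
    exact not_frequently_conditionB_of_irrationalityMeasure hα hs₀ ht₁ hu h1 h2' hβ1 hc hμ hsep
      hfreq
  · exact not_frequently_conditionB_of_norm_ne_one hα hs₀ ht₁ hu h1 h2' hβ1 hfreq

/-- OPEN MUTATION 2 (height): Roy's criterion in rank one with the height bound `≤ e^N` DELETED.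
Status: undetermined by cheap means (§3 (ii): integrality kills `S`-integral points, irrational
algebraic points need a nearly degenerate value lattice; no construction, no cheap proof).
[folklore] -/
def NoHeightVariantRankOne : Prop :=
  ∀ (y α : ℂ), y ≠ 0 → α ≠ 0 → ∀ (s₀ s₁ t₀ t₁ u : ℝ), RoyAdmissible s₀ s₁ t₀ t₁ u →
    (∀ᶠ N : ℕ in atTop, ∃ Q : MvPolynomial (Fin 2) ℤ, Q ≠ 0 ∧
      (Q.degreeOf 0 : ℝ) ≤ (N : ℝ) ^ t₀ ∧ (Q.degreeOf 1 : ℝ) ≤ (N : ℝ) ^ t₁ ∧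
      ∀ k m : ℕ, (k : ℝ) ≤ (N : ℝ) ^ s₀ → (m : ℝ) ≤ (N : ℝ) ^ s₁ →
        ‖aeval ![(m : ℂ) * y, α ^ m] (royD^[k] Q)‖ ≤ Real.exp (-(N : ℝ) ^ u)) →
    Transcendental ℚ y ∨ Transcendental ℚ α

/-- Sanity: the `∀ᶠ` version WITH the height bound (i.e. `RoyCriterion 1` read pairwise) holds —
this is the tree's rank-one theorem, restated in the format of the two open mutations.
[cite: Roy2001, §1 (rank one = Hermite–Lindemann)] -/
theorem eventuallyVariantRankOne_holds :
    ∀ (y α : ℂ), y ≠ 0 → α ≠ 0 → ∀ (s₀ s₁ t₀ t₁ u : ℝ), RoyAdmissible s₀ s₁ t₀ t₁ u →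
      RoyConditionB y α s₀ s₁ t₀ t₁ u → Transcendental ℚ y ∨ Transcendental ℚ α := by
  intro y α hy hα s₀ s₁ t₀ t₁ u hadm hB
  obtain ⟨d, hd1, hd⟩ := royThm1BtoA_holds y α hα s₀ s₁ t₀ t₁ u hadm hB
  by_contra hcon
  rw [not_or] at hcon
  have hya : IsAlgebraic ℚ y := not_not.mp hcon.1
  have hαa : IsAlgebraic ℚ α := not_not.mp hcon.2
  have hd0 : ((d : ℂ) * y) ≠ 0 := mul_ne_zero (by exact_mod_cast (show d ≠ 0 by omega)) hy
  have htr : Transcendental ℚ (cexp ((d : ℂ) * y)) :=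
    transcendental_exp_holds ((isAlgebraic_nat d).mul hya) hd0
  exact htr (hd ▸ hαa.pow d)

/-!
## WHY IT RESISTS (the negative side's census, cycle 1)

1. NO DAYLIGHT BETWEEN CRUX AND SUMMIT. `crux_iff_summit` is a kernel theorem: the polynomial
   clothing (window (1), heights, `D^k`, the points `(Σ mⱼyⱼ, Π αⱼ^{mⱼ})`) is stripped by
   `Roy2001_iff_holds`, so no junk in `RoyHypothesis`/`RoyAdmissible`/`mvPolyHeight`/`royD` can be
   exploited against the crux without ALSO refuting `Schanuel` — and conversely every encoding bug
   would have shown up as a refutation of `RoyCriterion 1`, which is instead PROVED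
   (`crux_rank_one`). The negative lemmas of §1–§2 confirm the encoding is tight exactly where Roy's
   text is: `y` linearly independent, `α ∈ (ℂˣ)ˡ`, conclusion `≥ l`.
2. WHAT A KILL IS. By `not_crux_iff_exists_counterexample` + `two_le_of_not_royCriterion` +
   `crux_iff_ecl_empty`: a `ℚ`-linearly independent `y ∈ (ecl ∅)ˡ`, `l ≥ 2`, and a non-zero
   `F ∈ ℤ[Y₁..Y_l, Z₁..Z_l]`-elimination showing `trdeg ℚ(y, e^y) ≤ l − 1` — i.e. an EXACT algebraic
   relation among specific exponential constants. No finite-precision computation certifies an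
   exact relation (PSLQ-type searches can only EXCLUDE relations below a degree/height bound), so a
   kill must be a symbolic identity; every symbolic family one can write down is closed off by a
   theorem: `y ⊂ ℚ̄` (Lindemann–Weierstrass, tree `algebraicIndependent_exp_holds`), `l = 1`
   (Hermite–Lindemann), `e^y ⊂ ℚ̄` with a LINEAR relation (Baker), `(π, e^π)` (Nesterenko),
   functional identities (Ax–Schanuel, tree `ax_schanuel_holds`, which is what puts essential
   counterexamples inside `ecl ∅`).
3. RANK 2 ALREADY CONTAINS `e ⊥ π`, `e ⊥ e^e`, `log 2 ⊥ 2^{√2}`, `π ⊥ log 2`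
   (`royCriterion_two_iff_schanuelTwo`; Roy 2001 p. 183), open since Lang 1966; the tree registers
   `ExpOnePiAlgebraicIndependent` as an open `@[conjecture]` with no expected discharge either way.
4. THE ONLY STRUCTURED ¬SC SCENARIO IN PRINT is soft and undecidable by soft means: Bays–Kirby's
   quasiminimal fields `𝔹_P` (cardinality `𝔠`, Zilber's axioms 1, 2, 4, 5, with the formal `e` and
   `2πi` algebraically DEPENDENT via an admissible `P`) — "One could conjecture that `ℂ_exp` is
   isomorphic to one of these" (tree barrier `Literature.Barriers.Schanuel.AxiomsDoNotForceSchanuel`,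
   [BaysKirby2018ANT §9.2]); `ℂ_exp ≅ 𝔹_P` would kill the crux through `not_crux_of_not_expOnePi…`
   (`P(e, 2πi) = 0`), while `ℂ_exp ≅ 𝔹` (Zilber) proves it. Deciding between them is exactly the
   transcendence question of the kill menu (§0d), untouched by every catalogued technique class:
   `AlgebraicIndependenceOfLogarithms` and `LargeTranscendenceDegree` APPLY to the target, while
   the soft classes cut BOTH ways — `Th(ℂ_exp)` has models violating SP (ultrapowers;
   `SchanuelPropertyNotFirstOrder`) and Zilber's axioms minus SP have models with SP (`𝔹`) and
   without (`𝔹_P`; `AxiomsDoNotForceSchanuel`), so neither a proof nor a DISPROOF of the crux can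
   proceed from first-order / soft-axiomatic properties of `ℂ_exp` alone.
5. NUMERICS CAN ONLY EXCLUDE: integer-relation searches bound the height/degree of a putative
   relation from below (kit job `j011417`, PSLQ on the rank-2 pairs; Bailey 1988, Math. Comp. 50,
   for `e, π` — acquisition `acq-05654` pending for the printed bounds); they can never certify one.
So the crux is exactly as hard as the summit, rank by rank; the disprover's useful output is the
load-bearing census above (encoding confidence for provers), the rank/shape reductions
(`crux_iff_reduced`) and the kill menu — not a kill.
-/

end Summit.Schanuel.Schanuel.Cruxes.RoyThesisTyped.Disproof

end
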